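import Summits.AtomisticToContinuum.BoseEinsteinCondensation.Theses.BECThomsonPrinciple
import Summits.AtomisticToContinuum.BoseEinsteinCondensation.Theses.BECPeriodicReduction
import Summits.AtomisticToContinuum.BoseEinsteinCondensation.Theses.BECConjugateDomination
import Literature.MathematicalPhysics.QuantumManyBody.SwapPurity
import Literature.MathematicalPhysics.QuantumManyBody.PeriodicHeatFlowSpectral
import Literature.MathematicalPhysics.QuantumManyBody.PeriodicGroundStateFeynmanKacProofs
import Literature.MathematicalPhysics.QuantumManyBody.PeriodizedPotentialNearestImage
import Literature.MathematicalPhysics.QuantumManyBody.PeriodicKyFanGapFeynmanKac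
import Literature.MathematicalPhysics.QuantumManyBody.PeriodicClusteringFromKyFanGap
import Mathlib.MeasureTheory.Integral.Prod
import Mathlib.MeasureTheory.Measure.WithDensity
import Mathlib.MeasureTheory.Function.L2Space
import Mathlib.Analysis.InnerProductSpace.Basic
import Literature.MathematicalPhysics.QuantumManyBody.BoseGasFreeDirichletBEC
import Literature.MathematicalPhysics.QuantumManyBody.CondensateOccupationStability
import Literature.Probability.Divergences.KLDivConvexity
import Mathlib.InformationTheory.KullbackLeibler.ChainRule

/-!
# Line `entropy-swap` (crux idea `entropy-budget-swap-transfer`, ideator 4's `Sketch.lean`) for crux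
# `PeriodicToDirichlet` (stmt-AtomisticToContinuum-9483) — SKELETON v3.1 (lead c2, 2026-08-16)

Route `BECThomsonPrinciple`; crux `PeriodicToDirichlet := PeriodicBEC → _root_.BoseEinsteinCondensation`.

The line (Yau's relative-entropy lever, mode-free): for a BOUNDED admissible `v ≢ 0`, at small density
`ρ`, with `N = n+1`, `ℓ = L_N(ρ) = (N/ρ)^{1/3}` and the torus Feynman–Kac ground state `Φ` of the SAME
`N` particles on the torus whose cell IS the Dirichlet box (geometry `m = 0`: no density mismatch,
no dilation step):
`A` at `(v, ρ)` ⟹ `n₀(Φ) ≥ cN` (stub `TorusCondensateFloor`) ⟹ `tr γ_Φ²/N² = swapPurity ≥ c²`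
(stub `OccupationSqLeSwapPurity`, Cauchy–Schwarz) `= E_{P⊗P}[σ_Φ]` (stub `SwapPurityDisintegration`);
the torus overlap `σ_Φ` concentrates at speed `N` (stub R2 `TorusOverlapConcentration`); the bath law
`Q` of ANY Dirichlet `δ`-near-minimiser `Ψ` has `KL(Q‖P) = o(N)` (stub R1 `EntropyBudget`) so
`Q⊗Q` cannot charge the `P⊗P`-rare event `{σ_Φ < c²/2}` (entropy–event bound, glue); `σ_Ψ ≥ κσ_Φ − ε`
in `Q⊗Q`-measure (stub R3 `OverlapStability`); hence `swapPurity(Ψ) ≥ c''`, `λ_max(γ_Ψ) ≥ N·swapPurity`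
(Penrose–Onsager, tree) for all `δ`-near-minimisers, i.e. `condensateNumber ≥ c''N`. Bounded `v ≡ 0`
on `[0,∞)` is the free gas (`hasGroundStateBEC_zero`); everything beyond bounded potentials is the
pooled item `BECConjugateDomination.HardCoreExtension` (stmt-AtomisticToContinuum-11786), whose
hypothesis class (finite, `C²`, finite range) consists of bounded potentials.

Reshapes w.r.t. the ideator's `EntropySwapSketch.lean`: (i) `m = 0` (drops R1′/R3′ and the dilation);
(ii) R3's quantifiers corrected to `∃ κ ∀ ε` (as typed by the ideator, `∀ ε ∃ κ`, R3 is trivially true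
with `κ = ε` and useless); (iii) `SwapPurityDisintegration` needs `Ψ ∈ L²` (false as typed without it);
(iv) non-triviality of `v` as `∫ v(|x|)dx ≠ 0` (⇔ `a > 0` for bounded `v`, but cheaper to feed).

v2: the Yau-chain assembly is PROVED here (`assembly`, glue); stubs 1a/1b/2 LANDED (p111290, p111990,
p111019) and are imported; R1–R3 are the research content; stub 6 is the pooled item stmt-11786.
-/

noncomputable section

namespace Summit.AtomisticToContinuum.BoseEinsteinCondensation.Cruxes.PeriodicToDirichlet.EntropySwap

open Literature.MathematicalPhysics.QuantumManyBody.BoseGas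
open _root_.MeasureTheory _root_.Filter _root_.InformationTheory _root_.ProbabilityTheory
open scoped ENNReal NNReal ComplexConjugate
open Summit.AtomisticToContinuum.BoseEinsteinCondensation.Theses


/-! ### Appendix L: the three LANDED stubs, pasted verbatim (namespace `Landed`) while the farm has
not rebuilt their tree modules `Theorems/BECThomsonPrinciplePeriodicToDirichlet{SwapPurityDisintegration,
TorusCondensateFloor,OccupationSqLeSwapPurity,FlatnessTransfer}.lean` (p111019, p111290, p111990, p113719);
v4 will import them. -/

namespace Landed

section L2


/-- If the slice `ψ_Y = Ψ(· :: Y)` has `‖ψ_Y‖₂ = 0`, every pairing `⟨ψ_{Y'}, ψ_Y⟩` vanishes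
(the slice is `0` a.e., hence so is the integrand). [folklore] -/
theorem integral_conj_mul_vecCons_eq_zero_of_right {n : ℕ} {Ψ : Config (n + 1) → ℂ}
    (hΨ : Measurable Ψ) (Y Y' : Config n)
    (h0 : ∫⁻ x, (‖Ψ (Matrix.vecCons x Y)‖₊ : ℝ≥0∞) ^ 2 = 0) :
    ∫ x, conj (Ψ (Matrix.vecCons x Y')) * Ψ (Matrix.vecCons x Y) = 0 := by
  have hae : ∀ᵐ x : Space, Ψ (Matrix.vecCons x Y) = 0 := by
    have h := (lintegral_eq_zero_iff
      ((measurable_comp_vecCons_left hΨ Y).nnnorm.coe_nnreal_ennreal.pow_const 2)).1 h0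
    filter_upwards [h] with x hx
    simpa using hx
  refine integral_eq_zero_of_ae ?_
  filter_upwards [hae] with x hx
  simp [hx]

/-- If the slice `ψ_{Y'} = Ψ(· :: Y')` has `‖ψ_{Y'}‖₂ = 0`, every pairing `⟨ψ_{Y'}, ψ_Y⟩` vanishes
(the slice is `0` a.e., hence so is the integrand). [folklore] -/
theorem integral_conj_mul_vecCons_eq_zero_of_left {n : ℕ} {Ψ : Config (n + 1) → ℂ}
    (hΨ : Measurable Ψ) (Y Y' : Config n)
    (h0 : ∫⁻ x, (‖Ψ (Matrix.vecCons x Y')‖₊ : ℝ≥0∞) ^ 2 = 0) :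
    ∫ x, conj (Ψ (Matrix.vecCons x Y')) * Ψ (Matrix.vecCons x Y) = 0 := by
  have hae : ∀ᵐ x : Space, Ψ (Matrix.vecCons x Y') = 0 := by
    have h := (lintegral_eq_zero_iff
      ((measurable_comp_vecCons_left hΨ Y').nnnorm.coe_nnreal_ennreal.pow_const 2)).1 h0
    filter_upwards [h] with x hx
    simpa using hx
  refine integral_eq_zero_of_ae ?_
  filter_upwards [hae] with x hx
  simp [hx]

/-- Pointwise cancellation behind the disintegration: for slices of finite norm,
`m(Y) · (m(Y') · (|K(Y,Y')|² / (m(Y) m(Y')))) = |K(Y,Y')|²`, the degenerate cases `m(Y) = 0` or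
`m(Y') = 0` holding because then `K(Y, Y') = 0`. [folklore] -/
theorem lintegral_mul_condOverlap_cancel {n : ℕ} {Ψ : Config (n + 1) → ℂ} (hΨ : Measurable Ψ)
    (Y Y' : Config n) (hY : ∫⁻ x, (‖Ψ (Matrix.vecCons x Y)‖₊ : ℝ≥0∞) ^ 2 ≠ ⊤)
    (hY' : ∫⁻ x, (‖Ψ (Matrix.vecCons x Y')‖₊ : ℝ≥0∞) ^ 2 ≠ ⊤) :
    (∫⁻ x, (‖Ψ (Matrix.vecCons x Y)‖₊ : ℝ≥0∞) ^ 2) *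
        ((∫⁻ x, (‖Ψ (Matrix.vecCons x Y')‖₊ : ℝ≥0∞) ^ 2) *
          ((‖∫ x, conj (Ψ (Matrix.vecCons x Y')) * Ψ (Matrix.vecCons x Y)‖₊ : ℝ≥0∞) ^ 2 /
            ((∫⁻ x, (‖Ψ (Matrix.vecCons x Y)‖₊ : ℝ≥0∞) ^ 2) *
              ∫⁻ x, (‖Ψ (Matrix.vecCons x Y')‖₊ : ℝ≥0∞) ^ 2))) =
      (‖∫ x, conj (Ψ (Matrix.vecCons x Y')) * Ψ (Matrix.vecCons x Y)‖₊ : ℝ≥0∞) ^ 2 := by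
  rw [← mul_assoc]
  refine ENNReal.mul_div_cancel' (fun h0 => ?_) (fun htop => ?_)
  · rcases mul_eq_zero.1 h0 with h | h
    · rw [integral_conj_mul_vecCons_eq_zero_of_right hΨ Y Y' h]
      simp
    · rw [integral_conj_mul_vecCons_eq_zero_of_left hΨ Y Y' h]
      simp
  · exact absurd htop (ENNReal.mul_ne_top hY hY')

/-- **Disintegration of the swap purity over two independent baths** (stub
`stub_swapPurityDisintegration` of the line `entropy-swap`, crux `PeriodicToDirichlet`): for a
measurable `Ψ ∈ L²((ℝ³)^{n+1})`, with bath law `Q = (∫ |Ψ(x :: Y)|² dx) dY` and conditional overlap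
`σ_Ψ(Y, Y') = |⟨ψ_{Y'}, ψ_Y⟩|² / (‖ψ_Y‖₂² ‖ψ_{Y'}‖₂²)`,
`swapPurity n Ψ = ∫ dQ(Y) ∫ dQ(Y') σ_Ψ(Y, Y')` (`tr γ_Ψ²/N² = E_{Q⊗Q}[σ_Ψ]`). Tonelli plus the a.e.
cancellation `lintegral_mul_condOverlap_cancel`; the `L²` hypothesis makes `{‖ψ_Y‖₂ = ∞}` null.
[folklore] -/
theorem stub_swapPurityDisintegration :
    ∀ (n : ℕ) (Ψ : Config (n + 1) → ℂ), Measurable Ψ → (∫⁻ X, (‖Ψ X‖₊ : ℝ≥0∞) ^ 2) ≠ ⊤ →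
      swapPurity n Ψ =
        ∫⁻ Y, ∫⁻ Y',
          (‖∫ x, (starRingEnd ℂ) (Ψ (Matrix.vecCons x Y')) * Ψ (Matrix.vecCons x Y)‖₊ : ℝ≥0∞) ^ 2 /
            ((∫⁻ x, (‖Ψ (Matrix.vecCons x Y)‖₊ : ℝ≥0∞) ^ 2) *
              ∫⁻ x, (‖Ψ (Matrix.vecCons x Y')‖₊ : ℝ≥0∞) ^ 2)
          ∂(volume.withDensity fun Y => ∫⁻ x, (‖Ψ (Matrix.vecCons x Y)‖₊ : ℝ≥0∞) ^ 2)
          ∂(volume.withDensity fun Y => ∫⁻ x, (‖Ψ (Matrix.vecCons x Y)‖₊ : ℝ≥0∞) ^ 2) := by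
  intro n Ψ hΨ hfin
  -- the bath density `m(Y) = ‖ψ_Y‖₂²`: measurable, of total mass `‖Ψ‖₂² < ∞`, hence finite a.e.
  have hmm : Measurable fun Y : Config n =>
      ∫⁻ x : Space, (‖Ψ (Matrix.vecCons x Y)‖₊ : ℝ≥0∞) ^ 2 :=
    measurable_lintegral_sq_nnnorm_vecCons hΨ
  have hae : ∀ᵐ Y : Config n, (∫⁻ x : Space, (‖Ψ (Matrix.vecCons x Y)‖₊ : ℝ≥0∞) ^ 2) < ⊤ :=
    ae_lt_top hmm (by rwa [lintegral_lintegral_sq_nnnorm_vecCons hΨ])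
  -- unfold the outer `withDensity` integral
  rw [swapPurity_eq_lintegral_lintegral hΨ,
    lintegral_withDensity_eq_lintegral_mul_non_measurable _ hmm hae]
  refine lintegral_congr_ae ?_
  filter_upwards [hae] with Y hY
  -- unfold the inner one and pull `m(Y) < ∞` inside
  simp only [Pi.mul_apply]
  rw [lintegral_withDensity_eq_lintegral_mul_non_measurable _ hmm hae,
    ← lintegral_const_mul' _ _ hY.ne]
  refine lintegral_congr_ae ?_
  filter_upwards [hae] with Y' hY'
  simp only [Pi.mul_apply]
  exact (lintegral_mul_condOverlap_cancel hΨ Y Y' hY.ne hY'.ne).symm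

end L2

section L1a


/-! ### Private helpers -/

/-- `L_N = (N/ρ)^{1/3} → ∞` along `N = m + 1`. [folklore] -/
private theorem tendsto_sideLength_succ {ρ : ℝ} (hρ : 0 < ρ) :
    Tendsto (fun m : ℕ => sideLength ρ (m + 1)) atTop atTop := by
  have h : Tendsto (fun n : ℕ => sideLength ρ n) atTop atTop := by
    unfold sideLength
    exact (tendsto_rpow_atTop (by norm_num : (0 : ℝ) < 1 / 3)).comp
      (tendsto_natCast_atTop_atTop.atTop_div_const hρ)
  exact h.comp (tendsto_add_atTop_nat 1)

/-- `∫ ‖F - G‖² = ∫ ‖F‖² - 2 Re ∫ conj F · G + ∫ ‖G‖²` for `F, G ∈ L²(μ; ℂ)`. [folklore] -/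
private theorem integral_norm_sub_sq_eq {α : Type*} [MeasurableSpace α] {μ : Measure α}
    {F G : α → ℂ} (hF : MemLp F 2 μ) (hG : MemLp G 2 μ) :
    ∫ x, ‖F x - G x‖ ^ 2 ∂μ =
      (∫ x, ‖F x‖ ^ 2 ∂μ) - 2 * (∫ x, conj (F x) * G x ∂μ).re + ∫ x, ‖G x‖ ^ 2 ∂μ := by
  have hpt : ∀ x, ‖F x - G x‖ ^ 2 = (‖F x‖ ^ 2 - 2 * (conj (F x) * G x).re) + ‖G x‖ ^ 2 := by
    intro x
    rw [@norm_sub_sq ℂ, RCLike.inner_apply', RCLike.re_to_complex]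
  have hFc : MemLp (fun x => conj (F x)) 2 μ :=
    hF.of_le (Complex.continuous_conj.comp_aestronglyMeasurable hF.1)
      (Eventually.of_forall fun x => by rw [Complex.norm_conj])
  have hFG : Integrable (fun x => conj (F x) * G x) μ := hFc.integrable_mul hG
  have hF2 : Integrable (fun x => ‖F x‖ ^ 2) μ := hF.norm.integrable_sq
  have hG2 : Integrable (fun x => ‖G x‖ ^ 2) μ := hG.norm.integrable_sq
  have hre : Integrable (fun x => 2 * (conj (F x) * G x).re) μ := by
    have := hFG.re.const_mul 2
    simpa only [RCLike.re_to_complex] using this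
  have hre_eq : ∫ x, (conj (F x) * G x).re ∂μ = (∫ x, conj (F x) * G x ∂μ).re := by
    have := integral_re hFG
    simpa only [RCLike.re_to_complex] using this
  simp_rw [hpt]
  rw [integral_add (f := fun x => ‖F x‖ ^ 2 - 2 * (conj (F x) * G x).re) (g := fun x => ‖G x‖ ^ 2)
      (hF2.sub hre) hG2,
    integral_sub (f := fun x => ‖F x‖ ^ 2) (g := fun x => 2 * (conj (F x) * G x).re) hF2 hre,
    integral_const_mul, hre_eq]

/-- **The distance to the ground state up to a phase**: for a periodic trial state `Ψ`, a real
`Φ ∈ L²(cell)` with `∫_cell Φ² = 1`, `s = ∫_cell conj Ψ · Φ` and the phase `θ = -arg s`,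
`∫_cell |Ψ - e^{iθ}Φ|² = 2 - 2|s|`. [folklore] -/
private theorem integral_norm_sub_phase_mul_sq {N : ℕ} {L : ℝ} (Ψ : PeriodicTrialState N L)
    {Φ : Config N → ℝ} (hΦ : MemLp Φ 2 (volume.restrict (cellN N L)))
    (hΦ1 : ∫ X in cellN N L, Φ X ^ 2 = 1) :
    ∫ X in cellN N L, ‖Ψ.ψ X -
        Complex.exp (↑(-(Complex.arg (∫ Y in cellN N L, conj (Ψ.ψ Y) * (Φ Y : ℂ)))) * Complex.I) *
          (Φ X : ℂ)‖ ^ 2 =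
      2 - 2 * ‖∫ Y in cellN N L, conj (Ψ.ψ Y) * (Φ Y : ℂ)‖ := by
  set s : ℂ := ∫ Y in cellN N L, conj (Ψ.ψ Y) * (Φ Y : ℂ) with hs
  set c : ℂ := Complex.exp (↑(-(Complex.arg s)) * Complex.I) with hc
  have hc1 : ‖c‖ = 1 := Complex.norm_exp_ofReal_mul_I _
  have hcs : c * s = (‖s‖ : ℂ) := by
    conv_lhs => rw [← Complex.norm_mul_exp_arg_mul_I s]
    rw [hc, mul_left_comm, ← Complex.exp_add]
    have : (↑(-(Complex.arg s)) : ℂ) * Complex.I + ↑(Complex.arg s) * Complex.I = 0 := by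
      push_cast; ring
    rw [this, Complex.exp_zero, mul_one]
  have hG : MemLp (fun X => c * (Φ X : ℂ)) 2 (volume.restrict (cellN N L)) :=
    (hΦ.ofReal (K := ℂ)).const_mul c
  rw [integral_norm_sub_sq_eq Ψ.memLp_two hG]
  -- `∫ ‖Ψ‖² = 1`
  have h1 : ∫ X in cellN N L, ‖Ψ.ψ X‖ ^ 2 = 1 := by
    rw [integral_cellN_norm_sq_eq_toReal L Ψ.contDiff.continuous, Ψ.norm_eq, ENNReal.toReal_one]
  -- `∫ ‖cΦ‖² = 1`
  have h2 : ∫ X in cellN N L, ‖c * (Φ X : ℂ)‖ ^ 2 = 1 := by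
    rw [← hΦ1]
    refine integral_congr_ae (Eventually.of_forall fun X => ?_)
    simp only [norm_mul, hc1, one_mul, Complex.norm_real, Real.norm_eq_abs, sq_abs]
  -- `∫ conj Ψ · cΦ = c s = |s|`
  have h3 : ∫ X in cellN N L, conj (Ψ.ψ X) * (c * (Φ X : ℂ)) = (‖s‖ : ℂ) := by
    rw [← hcs, hs, ← integral_const_mul]
    refine integral_congr_ae (Eventually.of_forall fun X => ?_)
    simp only
    ring
  rw [h1, h2, h3, Complex.ofReal_re]
  ring

/-- **Near-minimisers are close to the Feynman–Kac ground state up to a phase** (fixed `N`, `L`):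
for measurable `v` with bounded periodisation `v^per ≤ C` on the torus of side `L > 0` and a
Feynman–Kac ground state `Φ`, for every `η > 0` there is `δ > 0` such that every periodic
`δ`-near-minimiser `Ψ` satisfies `∫_cell |Ψ - e^{iθ}Φ|² ≤ η` for some phase `θ` (two-level Rayleigh
bound below the simple ground state, `E₀ + γ(1 - |⟨Φ,Ψ⟩|²) ≤ 𝓔^per[Ψ]`). [folklore] -/
private theorem exists_phase_sq_dist_le {N : ℕ} {L : ℝ} (hL : 0 < L) {v : ℝ → ℝ≥0∞}
    (hvm : Measurable v) {C : ℝ≥0} (hC : ∀ x, periodizedPotential v L x ≤ C) {Φ : Config N → ℝ}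
    (hΦ : IsPeriodicGroundStateFK v L Φ) {η : ℝ} (hη : 0 < η) :
    ∃ δ : ℝ≥0∞, 0 < δ ∧ ∀ Ψ : PeriodicTrialState N L,
      periodicEnergy v Ψ ≤ periodicGroundStateEnergy v N L + δ →
        ∃ θ : ℝ, ∫ X in cellN N L, ‖Ψ.ψ X - Complex.exp (θ * Complex.I) * (Φ X : ℂ)‖ ^ 2 ≤ η := by
  obtain ⟨γ, hγ, htwo⟩ := hΦ.exists_twoLevel hvm hL hC
  refine ⟨ENNReal.ofReal (γ * η / 2), ENNReal.ofReal_pos.2 (by positivity), fun Ψ hΨ => ?_⟩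
  have hE : periodicGroundStateEnergy v N L ≠ ⊤ := hΦ.energy_ne_top
  have hlow := ofReal_le_periodicEnergy_of_twoLevel hL hvm hC
    (fun f => ∫ X in cellN N L, Φ X * f X) (fun k => by positivity)
    (tendsto_pow_atTop_nhds_zero_of_lt_one (by norm_num) (by norm_num)) htwo Ψ
  dsimp only at hlow
  set E₀ : ℝ := (periodicGroundStateEnergy v N L).toReal with hE₀
  set A : ℝ := (∫ X in cellN N L, Φ X * (Ψ.ψ X).re) ^ 2 +
    (∫ X in cellN N L, Φ X * (Ψ.ψ X).im) ^ 2 with hAdef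
  have hA : 1 - A ≤ η / 2 := by
    have h1 : ENNReal.ofReal (E₀ + γ * (1 - A)) ≤ ENNReal.ofReal (E₀ + γ * η / 2) := by
      calc ENNReal.ofReal (E₀ + γ * (1 - A)) ≤ periodicEnergy v Ψ := hlow
        _ ≤ periodicGroundStateEnergy v N L + ENNReal.ofReal (γ * η / 2) := hΨ
        _ = ENNReal.ofReal (E₀ + γ * η / 2) := by
            rw [ENNReal.ofReal_add ENNReal.toReal_nonneg (by positivity),
              ENNReal.ofReal_toReal hE]
    have h2 := (ENNReal.ofReal_le_ofReal_iff (by positivity)).1 h1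
    nlinarith
  -- the overlap `s = ⟨Ψ, Φ⟩_cell`, `|s|² = A`
  set s : ℂ := ∫ Y in cellN N L, conj (Ψ.ψ Y) * (Φ Y : ℂ) with hs
  have hsA : ‖s‖ ^ 2 = A := norm_sq_setIntegral_conj_mul_ofReal hΦ.memLp_two Ψ
  refine ⟨-(Complex.arg s), ?_⟩
  rw [integral_norm_sub_phase_mul_sq Ψ hΦ.memLp_two hΦ.setIntegral_sq]
  by_cases hs1 : ‖s‖ ≤ 1
  · nlinarith [mul_nonneg (sub_nonneg.2 hs1) (norm_nonneg s)]
  · push Not at hs1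
    linarith

/-- **The floor transfer at fixed `N`, `L`.** If every periodic `δ`-near-minimiser (`δ > 0`) has
`n₀ ≥ cN`, then the Feynman–Kac ground state `Φ` (bounded periodisation, `L > 0`, `Φ` continuous)
has `n₀(Φ) ≥ (c/2)N`: a near-minimiser at slack `min(δ, δ_η)` exists since `E₀ ≠ ⊤` is an infimum,
it is `η = (c/4)²`-close to `e^{iθ}Φ` in `L²(cell)`, and `n₀` is phase invariant and
`2N√η`-Lipschitz on the unit ball. [folklore] -/
private theorem floor_transfer {N : ℕ} {L : ℝ} (hL : 0 < L) {v : ℝ → ℝ≥0∞} (hvm : Measurable v)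
    {C : ℝ≥0} (hC : ∀ x, periodizedPotential v L x ≤ C) {Φ : Config N → ℝ}
    (hΦ : IsPeriodicGroundStateFK v L Φ) (hcont : Continuous Φ) {c : ℝ} (hc : 0 < c)
    {δ : ℝ≥0∞} (hδ : 0 < δ)
    (hfloor : ∀ Ψ : PeriodicTrialState N L,
      periodicEnergy v Ψ ≤ periodicGroundStateEnergy v N L + δ →
        ENNReal.ofReal (c * N) ≤ condensateOccupation N L Ψ.ψ) :
    ENNReal.ofReal (c / 2 * N) ≤ condensateOccupation N L (fun X => (Φ X : ℂ)) := by
  obtain ⟨δ₁, hδ₁, hnear⟩ :=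
    exists_phase_sq_dist_le hL hvm hC hΦ (η := (c / 4) ^ 2) (by positivity)
  have hδ' : 0 < min δ δ₁ := lt_min hδ hδ₁
  -- a near-minimiser at slack `min δ δ₁` exists: `E₀ ≠ ⊤` is an infimum
  obtain ⟨Ψ, hΨ⟩ : ∃ Ψ : PeriodicTrialState N L,
      periodicEnergy v Ψ < periodicGroundStateEnergy v N L + min δ δ₁ :=
    iInf_lt_iff.1 (ENNReal.lt_add_right hΦ.energy_ne_top hδ'.ne')
  have hΨδ : periodicEnergy v Ψ ≤ periodicGroundStateEnergy v N L + δ :=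
    hΨ.le.trans (add_le_add le_rfl (min_le_left _ _))
  have hΨδ₁ : periodicEnergy v Ψ ≤ periodicGroundStateEnergy v N L + δ₁ :=
    hΨ.le.trans (add_le_add le_rfl (min_le_right _ _))
  have hocc := hfloor Ψ hΨδ
  obtain ⟨θ, hθ⟩ := hnear Ψ hΨδ₁
  -- `e^{iθ}Φ` is continuous and cell-normalised
  have hcΦ : Continuous fun X => Complex.exp (θ * Complex.I) * (Φ X : ℂ) :=
    continuous_const.mul (Complex.continuous_ofReal.comp hcont)
  have hΦ1 : ∫⁻ X in cellN N L, (‖Complex.exp (θ * Complex.I) * (Φ X : ℂ)‖₊ : ℝ≥0∞) ^ 2 ≤ 1 := by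
    simp only [coe_nnnorm_mul_sq, coe_nnnorm_exp_mul_I_sq, one_mul]
    refine le_of_eq (Eq.trans (lintegral_congr fun X => ?_) hΦ.norm_eq)
    rw [ennnorm_sq_ofReal_periodic, ENNReal.ofReal_pow (hΦ.nonneg X)]
  -- Lipschitz continuity of `n₀` and phase invariance
  have hlip := condensateOccupation_le_add_of_sq_dist_le hL Ψ.contDiff.continuous hcΦ
    Ψ.norm_eq.le hΦ1 hθ
  rw [condensateOccupation_phase_mul, Real.sqrt_sq (by positivity : (0 : ℝ) ≤ c / 4)] at hlip
  have key : ENNReal.ofReal (c * N) ≤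
      condensateOccupation N L (fun X => (Φ X : ℂ)) + ENNReal.ofReal (c / 2 * N) := by
    refine hocc.trans (hlip.trans (le_of_eq ?_))
    congr 2
    ring
  have h := ofReal_sub_mul_le_of_le_add (by positivity : (0 : ℝ) ≤ c / 2) N key
  have h2 : c - c / 2 = c / 2 := by ring
  rwa [h2] at h

/-! ### The stub -/

/-- **Registered stub `stub_torusCondensateFloor`** (stub 1a of line `entropy-swap`, crux
stmt-AtomisticToContinuum-9483): the hypothesis `A` (periodic BEC for all `δ_N`-near-minimisers on
the torus of side `sideLength ρ N`, eventually in `N`) gives, for the same densities and eventually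
in `n`, the floor `n₀(Φ) ≥ (c/2)(n+1)` for every continuous Feynman–Kac torus ground state `Φ` of
`n + 1` particles, for BOUNDED `v` of finite range. [folklore] -/
theorem stub_torusCondensateFloor :
    ∀ v : ℝ → ℝ≥0∞, IsRepulsiveFiniteRange v → (∃ B : ℝ≥0, ∀ r, 0 ≤ r → v r ≤ B) →
      (∃ ρ₀ : ℝ, 0 < ρ₀ ∧ ∀ ρ : ℝ, 0 < ρ → ρ < ρ₀ → ∃ c : ℝ, 0 < c ∧ ∀ᶠ N : ℕ in atTop,
        ∃ δ : ℝ≥0∞, 0 < δ ∧ ∀ Ψ : PeriodicTrialState N (sideLength ρ N),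
          periodicEnergy v Ψ ≤ periodicGroundStateEnergy v N (sideLength ρ N) + δ →
            ENNReal.ofReal (c * N) ≤ condensateOccupation N (sideLength ρ N) Ψ.ψ) →
      ∃ ρ₁ : ℝ, 0 < ρ₁ ∧ ∀ ρ : ℝ, 0 < ρ → ρ < ρ₁ → ∃ c : ℝ, 0 < c ∧ ∀ᶠ n : ℕ in atTop,
        ∀ Φ : Config (n + 1) → ℝ, IsPeriodicGroundStateFK v (sideLength ρ (n + 1)) Φ → Continuous Φ →
          ENNReal.ofReal (c * (n + 1)) ≤
            condensateOccupation (n + 1) (sideLength ρ (n + 1)) (fun X => (Φ X : ℂ)) := by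
  intro v hv hbdd hA
  obtain ⟨hvm, R₀, hR₀⟩ := hv
  obtain ⟨B, hB⟩ := hbdd
  obtain ⟨ρ₀, hρ₀, hAρ⟩ := hA
  refine ⟨ρ₀, hρ₀, fun ρ hρ hρ' => ?_⟩
  obtain ⟨c, hc, hev⟩ := hAρ ρ hρ hρ'
  refine ⟨c / 2, by positivity, ?_⟩
  filter_upwards [(tendsto_add_atTop_nat 1).eventually hev,
    (tendsto_sideLength_succ hρ).eventually_gt_atTop (2 * R₀),
    (tendsto_sideLength_succ hρ).eventually_gt_atTop 0] with n hAn h2R hL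
  intro Φ hΦ hcont
  obtain ⟨δ, hδ, hfloor⟩ := hAn
  -- the periodisation is bounded by `B` once `2R₀ < L` (a single near image)
  have hC : ∀ x, periodizedPotential v (sideLength ρ (n + 1)) x ≤ (B : ℝ≥0∞) := fun x => by
    obtain ⟨n₀, hn₀⟩ := exists_periodizedPotential_eq_single hR₀ h2R hL x
    rw [hn₀]
    exact hB _ (norm_nonneg _)
  have key := floor_transfer hL hvm hC hΦ hcont hc hδ hfloor
  have hcast : c / 2 * ((n + 1 : ℕ) : ℝ) = c / 2 * ((n : ℝ) + 1) := by push_cast; ring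
  rwa [hcast] at key

end L1a

section L1b


/-! ### Two generic scalar lemmas -/

/-- `∫ |g|² = |∫ (|g| : ℂ)²|` in `ℝ≥0∞`, for `g ∈ L²`: the bridge between the `lintegral` of
`‖g‖₊²` and the complex Bochner integral of `(‖g‖ : ℂ)²`. [folklore] -/
theorem osp_lintegral_sq_eq_nnnorm_integral {α : Type*} [MeasurableSpace α] {μ : Measure α}
    {g : α → ℂ} (hg : AEStronglyMeasurable g μ) (hfin : ∫⁻ a, (‖g a‖₊ : ℝ≥0∞) ^ 2 ∂μ ≠ ⊤) :
    ∫⁻ a, (‖g a‖₊ : ℝ≥0∞) ^ 2 ∂μ = ‖∫ a, ((‖g a‖ : ℂ)) ^ 2 ∂μ‖₊ := by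
  have h1 : ∫ a, ‖g a‖ ^ 2 ∂μ = (∫⁻ a, (‖g a‖₊ : ℝ≥0∞) ^ 2 ∂μ).toReal := by
    rw [integral_eq_lintegral_of_nonneg_ae (f := fun a => ‖g a‖ ^ 2)
      (Filter.Eventually.of_forall fun a => sq_nonneg _)
      (hg.norm.aemeasurable.pow_const 2).aestronglyMeasurable]
    congr 1
    refine lintegral_congr fun a => ?_
    rw [ENNReal.ofReal_pow (norm_nonneg _), ofReal_norm, enorm_eq_nnnorm]
  have h2 : ∫ a, ((‖g a‖ : ℂ)) ^ 2 ∂μ = ((∫ a, ‖g a‖ ^ 2 ∂μ : ℝ) : ℂ) := by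
    rw [← integral_complex_ofReal]
    simp only [Complex.ofReal_pow]
  rw [h2, Complex.nnnorm_real, h1, ← enorm_eq_nnnorm, Real.enorm_eq_ofReal ENNReal.toReal_nonneg,
    ENNReal.ofReal_toReal hfin]

/-- **Squared norm of a parametric integral as a double integral**: for a jointly measurable
`F : α × β → ℂ` with `∫ (∫ |F(a, b)| db)² da < ∞`,
`∫ |∫ F(a, b) db|² da = ∫∫ (∫ F(a, b) conj F(a, b') da) d(b, b')`: expand
`|∫ F(a, ·)|² = (∫ F(a, b) db)(∫ conj F(a, b') db') = ∫∫ F(a, b) conj F(a, b')` and swap the `a`-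
and `(b, b')`-integrals (Fubini; the hypothesis is exactly the integrability of the triple
integrand). [folklore] -/
theorem osp_integral_sq_norm_integral {α β : Type*} [MeasurableSpace α] [MeasurableSpace β]
    {μ : Measure α} {ν : Measure β} [SFinite μ] [SFinite ν] {F : α → β → ℂ}
    (hF : Measurable (Function.uncurry F))
    (hfin : ∫⁻ a, (∫⁻ b, (‖F a b‖₊ : ℝ≥0∞) ∂ν) ^ 2 ∂μ ≠ ⊤) :
    ∫ a, ((‖∫ b, F a b ∂ν‖ : ℂ)) ^ 2 ∂μ =
      ∫ q : β × β, ∫ a, F a q.1 * conj (F a q.2) ∂μ ∂(ν.prod ν) := by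
  have hFa : ∀ a, Measurable (F a) := fun a => hF.of_uncurry_left
  -- the triple integrand is measurable and integrable
  have hH : Measurable fun z : α × (β × β) => F z.1 z.2.1 * conj (F z.1 z.2.2) := by
    have h1 : Measurable fun z : α × (β × β) => F z.1 z.2.1 :=
      hF.comp (measurable_fst.prodMk (measurable_fst.comp measurable_snd))
    have h2 : Measurable fun z : α × (β × β) => F z.1 z.2.2 :=
      hF.comp (measurable_fst.prodMk (measurable_snd.comp measurable_snd))
    exact h1.mul (Complex.continuous_conj.measurable.comp h2)
  have hint : Integrable (fun z : α × (β × β) => F z.1 z.2.1 * conj (F z.1 z.2.2))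
      (μ.prod (ν.prod ν)) := by
    refine ⟨hH.aestronglyMeasurable, ?_⟩
    rw [hasFiniteIntegral_iff_enorm]
    calc ∫⁻ z, ‖F z.1 z.2.1 * conj (F z.1 z.2.2)‖ₑ ∂μ.prod (ν.prod ν)
        = ∫⁻ a, ∫⁻ q, (‖F a q.1‖₊ : ℝ≥0∞) * ‖F a q.2‖₊ ∂ν.prod ν ∂μ := by
          rw [lintegral_prod _ hH.enorm.aemeasurable]
          refine lintegral_congr fun a => lintegral_congr fun q => ?_
          simp only [enorm_eq_nnnorm, nnnorm_mul, ENNReal.coe_mul, RCLike.nnnorm_conj]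
      _ = ∫⁻ a, (∫⁻ b, (‖F a b‖₊ : ℝ≥0∞) ∂ν) * ∫⁻ b, (‖F a b‖₊ : ℝ≥0∞) ∂ν ∂μ := by
          refine lintegral_congr fun a => ?_
          exact lintegral_prod_mul (hFa a).nnnorm.coe_nnreal_ennreal.aemeasurable
            (hFa a).nnnorm.coe_nnreal_ennreal.aemeasurable
      _ = ∫⁻ a, (∫⁻ b, (‖F a b‖₊ : ℝ≥0∞) ∂ν) ^ 2 ∂μ := by simp_rw [sq]
      _ < ⊤ := hfin.lt_top
  -- pointwise expansion of the square, then Fubini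
  have hpt : ∀ a, ((‖∫ b, F a b ∂ν‖ : ℂ)) ^ 2 =
      ∫ q : β × β, F a q.1 * conj (F a q.2) ∂(ν.prod ν) := by
    intro a
    rw [← Complex.mul_conj', ← integral_conj, ← integral_prod_mul]
  simp_rw [hpt]
  exact integral_integral_swap (f := fun a (q : β × β) => F a q.1 * conj (F a q.2)) hint

/-! ### Slices `Ψ_Y = Ψ(· :: Y)` and the kernel `G(x, x') = ∫ Ψ(x :: Y) conj Ψ(x' :: Y) dY` -/

variable {n : ℕ}

/-- **Tonelli, first coordinate outermost**: `∫ (∫ F(x :: Y) dY) dx = ∫ F(Z) dZ` for measurable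
`F ≥ 0` on `(ℝ³)^{n+1}`. [folklore] -/
theorem osp_lintegral_lintegral_vecCons {F : Config (n + 1) → ℝ≥0∞} (hF : Measurable F) :
    ∫⁻ x : Space, ∫⁻ Y : Config n, F (Matrix.vecCons x Y) = ∫⁻ Z, F Z := by
  rw [← measurePreserving_vecCons.lintegral_comp hF,
    lintegral_prod (fun p : Space × Config n => F (Matrix.vecCons p.1 p.2))
      (hF.comp measurable_vecCons).aemeasurable]

/-- The kernel `(x, x') ↦ G(x, x') = ∫ Ψ(x :: Y) conj Ψ(x' :: Y) dY` of `γ_Ψ/N` is (jointly)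
measurable. [folklore] -/
theorem osp_measurable_kernel {Ψ : Config (n + 1) → ℂ} (hΨ : Measurable Ψ) :
    Measurable fun q : Space × Space =>
      ∫ Y : Config n, Ψ (Matrix.vecCons q.1 Y) * conj (Ψ (Matrix.vecCons q.2 Y)) := by
  have h : Measurable fun r : (Space × Space) × Config n =>
      Ψ (Matrix.vecCons r.1.1 r.2) * conj (Ψ (Matrix.vecCons r.1.2 r.2)) := by
    have h1 : Measurable fun r : (Space × Space) × Config n => Ψ (Matrix.vecCons r.1.1 r.2) :=
      hΨ.comp (measurable_vecCons.comp ((measurable_fst.comp measurable_fst).prodMk measurable_snd))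
    have h2 : Measurable fun r : (Space × Space) × Config n => Ψ (Matrix.vecCons r.1.2 r.2) :=
      hΨ.comp (measurable_vecCons.comp ((measurable_snd.comp measurable_fst).prodMk measurable_snd))
    exact h1.mul (Complex.continuous_conj.measurable.comp h2)
  exact (h.stronglyMeasurable.integral_prod_right' (ν := (volume : Measure (Config n)))).measurable

/-- `∫∫ |G(x, x')|² dx dx' ≤ ‖Ψ‖₂⁴`: Cauchy–Schwarz `|G(x, x')|² ≤ ρ(x) ρ(x')` with the density
`ρ(x) = ∫ |Ψ(x :: Y)|² dY`, `∫ ρ = ‖Ψ‖₂²` (Tonelli). [folklore] -/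
theorem osp_lintegral_sq_kernel_le {Ψ : Config (n + 1) → ℂ} (hΨ : Measurable Ψ) :
    ∫⁻ q : Space × Space, (‖∫ Y : Config n, Ψ (Matrix.vecCons q.1 Y) *
        conj (Ψ (Matrix.vecCons q.2 Y))‖₊ : ℝ≥0∞) ^ 2 ≤ (∫⁻ Z, (‖Ψ Z‖₊ : ℝ≥0∞) ^ 2) ^ 2 := by
  set ρ : Space → ℝ≥0∞ := fun x => ∫⁻ Y : Config n, (‖Ψ (Matrix.vecCons x Y)‖₊ : ℝ≥0∞) ^ 2
    with hρ
  have hcol : ∀ x : Space, Measurable fun Y : Config n => Ψ (Matrix.vecCons x Y) := fun x =>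
    hΨ.comp (measurable_vecCons.comp (measurable_const.prodMk measurable_id))
  have hρm : Measurable ρ :=
    ((hΨ.comp measurable_vecCons).nnnorm.coe_nnreal_ennreal.pow_const 2).lintegral_prod_right'
  have hρi : ∫⁻ x, ρ x = ∫⁻ Z, (‖Ψ Z‖₊ : ℝ≥0∞) ^ 2 :=
    osp_lintegral_lintegral_vecCons (hΨ.nnnorm.coe_nnreal_ennreal.pow_const 2)
  calc _ ≤ ∫⁻ q : Space × Space, ρ q.1 * ρ q.2 :=
        lintegral_mono fun q => sq_nnnorm_integral_mul_conj_le (hcol q.1).aemeasurable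
          (hcol q.2).aemeasurable
    _ = (∫⁻ x, ρ x) * ∫⁻ x, ρ x := by
        rw [Measure.volume_eq_prod, lintegral_prod_mul hρm.aemeasurable hρm.aemeasurable]
    _ = (∫⁻ Z, (‖Ψ Z‖₊ : ℝ≥0∞) ^ 2) ^ 2 := by rw [hρi, sq]

/-- **`∫∫ |G(x, x')|² dx dx' = swapPurity n Ψ = ∫∫ |K(Y, Y')|² dY dY'`** (`tr γ² ` computed from
either kernel) for measurable `Ψ ∈ L²`: both sides equal the quadruple integral
`∫∫∫∫ Ψ(x::Y) conj Ψ(x::Y') conj Ψ(x'::Y) Ψ(x'::Y')` (Fubini, `osp_integral_sq_norm_integral`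
with `F((Y, Y'), x) = Ψ(x :: Y) conj Ψ(x :: Y')`). [folklore] -/
theorem osp_lintegral_sq_kernel_eq_swapPurity {Ψ : Config (n + 1) → ℂ} (hΨ : Measurable Ψ)
    (hfin : ∫⁻ Z, (‖Ψ Z‖₊ : ℝ≥0∞) ^ 2 ≠ ⊤) :
    ∫⁻ q : Space × Space, (‖∫ Y : Config n, Ψ (Matrix.vecCons q.1 Y) *
        conj (Ψ (Matrix.vecCons q.2 Y))‖₊ : ℝ≥0∞) ^ 2 = swapPurity n Ψ := by
  have h4 : (∫⁻ Z, (‖Ψ Z‖₊ : ℝ≥0∞) ^ 2) ^ 2 ≠ ⊤ := ENNReal.pow_ne_top hfin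
  have hslice : ∀ Y : Config n, Measurable fun x : Space => Ψ (Matrix.vecCons x Y) :=
    measurable_comp_vecCons_left hΨ
  set w : Config n → ℝ≥0∞ := fun Y => ∫⁻ x : Space, (‖Ψ (Matrix.vecCons x Y)‖₊ : ℝ≥0∞) ^ 2
    with hw
  have hwm : Measurable w := measurable_lintegral_sq_nnnorm_vecCons hΨ
  have hwi : ∫⁻ Y, w Y = ∫⁻ Z, (‖Ψ Z‖₊ : ℝ≥0∞) ^ 2 := lintegral_lintegral_sq_nnnorm_vecCons hΨ
  -- the integrand `F((Y, Y'), x) = Ψ(x :: Y) conj Ψ(x :: Y')` of the swap kernel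
  have hFm : Measurable fun p : (Config n × Config n) × Space =>
      Ψ (Matrix.vecCons p.2 p.1.1) * conj (Ψ (Matrix.vecCons p.2 p.1.2)) := by
    have h1 : Measurable fun p : (Config n × Config n) × Space => Ψ (Matrix.vecCons p.2 p.1.1) :=
      hΨ.comp (measurable_vecCons.comp (measurable_snd.prodMk (measurable_fst.comp measurable_fst)))
    have h2 : Measurable fun p : (Config n × Config n) × Space => Ψ (Matrix.vecCons p.2 p.1.2) :=
      hΨ.comp (measurable_vecCons.comp (measurable_snd.prodMk (measurable_snd.comp measurable_fst)))
    exact h1.mul (Complex.continuous_conj.measurable.comp h2)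
  have hAfin : ∫⁻ P : Config n × Config n, (∫⁻ x, (‖Ψ (Matrix.vecCons x P.1) *
      conj (Ψ (Matrix.vecCons x P.2))‖₊ : ℝ≥0∞)) ^ 2 ≠ ⊤ := by
    refine ne_top_of_le_ne_top h4 ?_
    calc _ ≤ ∫⁻ P : Config n × Config n, w P.1 * w P.2 := by
          refine lintegral_mono fun P => ?_
          have h : ∀ x, (‖Ψ (Matrix.vecCons x P.1) * conj (Ψ (Matrix.vecCons x P.2))‖₊ : ℝ≥0∞) =
              ‖Ψ (Matrix.vecCons x P.1)‖₊ * ‖Ψ (Matrix.vecCons x P.2)‖₊ := fun x => by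
            rw [nnnorm_mul, ENNReal.coe_mul, RCLike.nnnorm_conj]
          simp_rw [h]
          exact lintegral_mul_sq_le volume (hslice P.1).nnnorm.coe_nnreal_ennreal.aemeasurable
            (hslice P.2).nnnorm.coe_nnreal_ennreal.aemeasurable
      _ = (∫⁻ Y, w Y) * ∫⁻ Y, w Y := by
          rw [Measure.volume_eq_prod, lintegral_prod_mul hwm.aemeasurable hwm.aemeasurable]
      _ = _ := by rw [hwi, sq]
  -- (a local copy keeps the instance term for the product `Config n × Config n` small)
  haveI : SFinite (volume : Measure (Config n)) := inferInstance
  rw [osp_lintegral_sq_eq_nnnorm_integral (osp_measurable_kernel hΨ).aestronglyMeasurable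
      (ne_top_of_le_ne_top h4 (osp_lintegral_sq_kernel_le hΨ)), swapPurity,
    osp_lintegral_sq_eq_nnnorm_integral (measurable_swapKernel hΨ).aestronglyMeasurable
      (ne_top_of_le_ne_top h4 (swapPurity_le_lintegral_sq hΨ)),
    osp_integral_sq_norm_integral (F := fun (P : Config n × Config n) (x : Space) =>
      Ψ (Matrix.vecCons x P.1) * conj (Ψ (Matrix.vecCons x P.2))) hFm hAfin,
    ← Measure.volume_eq_prod]
  congr 2
  refine integral_congr_ae (Filter.Eventually.of_forall fun q => ?_)
  have hpt : ∀ P : Config n × Config n,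
      Ψ (Matrix.vecCons q.1 P.1) * conj (Ψ (Matrix.vecCons q.1 P.2)) *
          conj (Ψ (Matrix.vecCons q.2 P.1) * conj (Ψ (Matrix.vecCons q.2 P.2))) =
        Ψ (Matrix.vecCons q.1 P.1) * conj (Ψ (Matrix.vecCons q.2 P.1)) *
          conj (Ψ (Matrix.vecCons q.1 P.2) * conj (Ψ (Matrix.vecCons q.2 P.2))) := fun P => by
    simp only [map_mul, Complex.conj_conj]; ring
  simp_rw [hpt]
  rw [← Complex.mul_conj', ← integral_conj, ← integral_prod_mul, Measure.volume_eq_prod]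

/-! ### The Cauchy–Schwarz step -/

/-- **`S² ≤ ∫∫|G|² · ‖φ‖₂⁴`** for `S = ∫ |⟨φ, Ψ_Y⟩|² dY`: `S = ∫∫ conj φ(x) φ(x') G(x, x')`
(Fubini, `osp_integral_sq_norm_integral` with `F(Y, x) = conj φ(x) Ψ(x :: Y)`), then
Cauchy–Schwarz on `ℝ³ × ℝ³`. [folklore] -/
theorem osp_sliceOverlap_sq_le {φ : Space → ℂ} {Ψ : Config (n + 1) → ℂ} (hφ : Measurable φ)
    (hΨ : Measurable Ψ) (hφ2 : ∫⁻ x, (‖φ x‖₊ : ℝ≥0∞) ^ 2 ≠ ⊤)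
    (hfin : ∫⁻ Z, (‖Ψ Z‖₊ : ℝ≥0∞) ^ 2 ≠ ⊤) :
    (∫⁻ Y : Config n, (‖∫ x, conj (φ x) * Ψ (Matrix.vecCons x Y)‖₊ : ℝ≥0∞) ^ 2) ^ 2 ≤
      (∫⁻ q : Space × Space, (‖∫ Y : Config n, Ψ (Matrix.vecCons q.1 Y) *
        conj (Ψ (Matrix.vecCons q.2 Y))‖₊ : ℝ≥0∞) ^ 2) * (∫⁻ x, (‖φ x‖₊ : ℝ≥0∞) ^ 2) ^ 2 := by
  have hslice : ∀ Y : Config n, Measurable fun x : Space => Ψ (Matrix.vecCons x Y) :=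
    measurable_comp_vecCons_left hΨ
  -- the integrand `F(Y, x) = conj φ(x) Ψ(x :: Y)`
  have hFm : Measurable fun p : Config n × Space => conj (φ p.2) * Ψ (Matrix.vecCons p.2 p.1) :=
    (Complex.continuous_conj.measurable.comp (hφ.comp measurable_snd)).mul
      (hΨ.comp (measurable_vecCons.comp (measurable_snd.prodMk measurable_fst)))
  have ham : Measurable fun Y : Config n => ∫ x, conj (φ x) * Ψ (Matrix.vecCons x Y) :=
    (hFm.stronglyMeasurable.integral_prod_right' (ν := (volume : Measure Space))).measurable
  have hnn : ∀ (Y : Config n) (x : Space),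
      (‖conj (φ x) * Ψ (Matrix.vecCons x Y)‖₊ : ℝ≥0∞) = ‖φ x‖₊ * ‖Ψ (Matrix.vecCons x Y)‖₊ :=
    fun Y x => by rw [nnnorm_mul, ENNReal.coe_mul, RCLike.nnnorm_conj]
  -- `∫ (∫ |φ| |Ψ_Y|)² dY ≤ ‖φ‖² ‖Ψ‖² < ∞`
  have hAfin : ∫⁻ Y : Config n,
      (∫⁻ x, (‖conj (φ x) * Ψ (Matrix.vecCons x Y)‖₊ : ℝ≥0∞)) ^ 2 ≠ ⊤ := by
    refine ne_top_of_le_ne_top (ENNReal.mul_ne_top hφ2 hfin) ?_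
    calc _ ≤ ∫⁻ Y : Config n, (∫⁻ x, (‖φ x‖₊ : ℝ≥0∞) ^ 2) *
            ∫⁻ x, (‖Ψ (Matrix.vecCons x Y)‖₊ : ℝ≥0∞) ^ 2 := by
          refine lintegral_mono fun Y => ?_
          simp_rw [hnn]
          exact lintegral_mul_sq_le volume hφ.nnnorm.coe_nnreal_ennreal.aemeasurable
            (hslice Y).nnnorm.coe_nnreal_ennreal.aemeasurable
      _ = _ := by
          rw [lintegral_const_mul _ (measurable_lintegral_sq_nnnorm_vecCons hΨ),
            lintegral_lintegral_sq_nnnorm_vecCons hΨ]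
  -- `S < ∞`
  have hS : ∫⁻ Y : Config n, (‖∫ x, conj (φ x) * Ψ (Matrix.vecCons x Y)‖₊ : ℝ≥0∞) ^ 2 ≠ ⊤ := by
    refine ne_top_of_le_ne_top hAfin (lintegral_mono fun Y => ?_)
    gcongr
    exact enorm_integral_le_lintegral_enorm _
  -- the mode tensor `φ ⊗ conj φ`
  have hgm : Measurable fun q : Space × Space => φ q.1 * conj (φ q.2) :=
    (hφ.comp measurable_fst).mul (Complex.continuous_conj.measurable.comp (hφ.comp measurable_snd))
  have hgg : ∫⁻ q : Space × Space, (‖φ q.1 * conj (φ q.2)‖₊ : ℝ≥0∞) ^ 2 =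
      (∫⁻ x, (‖φ x‖₊ : ℝ≥0∞) ^ 2) ^ 2 := by
    have h : ∀ q : Space × Space, (‖φ q.1 * conj (φ q.2)‖₊ : ℝ≥0∞) ^ 2 =
        (‖φ q.1‖₊ : ℝ≥0∞) ^ 2 * (‖φ q.2‖₊ : ℝ≥0∞) ^ 2 := fun q => by
      rw [nnnorm_mul, ENNReal.coe_mul, RCLike.nnnorm_conj, mul_pow]
    simp_rw [h]
    rw [Measure.volume_eq_prod, lintegral_prod_mul
      (hφ.nnnorm.coe_nnreal_ennreal.pow_const 2).aemeasurable
      (hφ.nnnorm.coe_nnreal_ennreal.pow_const 2).aemeasurable, sq]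
  -- `S = |∫∫ G · conj(φ ⊗ conj φ)|`
  have hinner : ∀ q : Space × Space,
      ∫ Y : Config n, conj (φ q.1) * Ψ (Matrix.vecCons q.1 Y) *
          conj (conj (φ q.2) * Ψ (Matrix.vecCons q.2 Y)) =
        (∫ Y : Config n, Ψ (Matrix.vecCons q.1 Y) * conj (Ψ (Matrix.vecCons q.2 Y))) *
          conj (φ q.1 * conj (φ q.2)) := by
    intro q
    rw [← integral_mul_const]
    refine integral_congr_ae (Filter.Eventually.of_forall fun Y => ?_)
    simp only [map_mul, Complex.conj_conj]; ring
  rw [osp_lintegral_sq_eq_nnnorm_integral ham.aestronglyMeasurable hS,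
    osp_integral_sq_norm_integral
      (F := fun (Y : Config n) (x : Space) => conj (φ x) * Ψ (Matrix.vecCons x Y)) hFm hAfin]
  simp_rw [hinner]
  rw [← Measure.volume_eq_prod, ← hgg]
  exact sq_nnnorm_integral_mul_conj_le (osp_measurable_kernel hΨ).aemeasurable hgm.aemeasurable

/-! ### The registered stub -/

/-- **Stub `stub_occupationSqLeSwapPurity`** of line `entropy-swap` (crux `PeriodicToDirichlet`):
the operator-free Cauchy–Schwarz `⟨φ, ρ₁ φ⟩² ≤ tr ρ₁²`, i.e.
`occupation N φ Ψ ^ 2 ≤ N² · swapPurity n Ψ` (`N = n + 1`) for a measurable sub-normalised mode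
`φ` and a measurable `Ψ ∈ L²`. [folklore] -/
theorem stub_occupationSqLeSwapPurity :
    ∀ (n : ℕ) (φ : Space → ℂ) (Ψ : Config (n + 1) → ℂ), Measurable φ → Measurable Ψ →
      (∫⁻ x, (‖φ x‖₊ : ℝ≥0∞) ^ 2) ≤ 1 → (∫⁻ X, (‖Ψ X‖₊ : ℝ≥0∞) ^ 2) ≠ ⊤ →
        occupation (n + 1) φ Ψ ^ 2 ≤ ((n + 1 : ℕ) : ℝ≥0∞) ^ 2 * swapPurity n Ψ := by
  intro n φ Ψ hφ hΨ hφ1 hΨfin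
  have hφ2 : ∫⁻ x, (‖φ x‖₊ : ℝ≥0∞) ^ 2 ≠ ⊤ := ne_top_of_le_ne_top ENNReal.one_ne_top hφ1
  have key := osp_sliceOverlap_sq_le (n := n) hφ hΨ hφ2 hΨfin
  rw [osp_lintegral_sq_kernel_eq_swapPurity hΨ hΨfin] at key
  have key' : (∫⁻ Y : Config n,
      (‖∫ x, conj (φ x) * Ψ (Matrix.vecCons x Y)‖₊ : ℝ≥0∞) ^ 2) ^ 2 ≤ swapPurity n Ψ := by
    calc _ ≤ _ := key
      _ ≤ swapPurity n Ψ * 1 ^ 2 := by gcongr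
      _ = swapPurity n Ψ := by rw [one_pow, mul_one]
  have hocc : occupation (n + 1) φ Ψ = ((n + 1 : ℕ) : ℝ≥0∞) *
      ∫⁻ Y : Config n, (‖∫ x, conj (φ x) * Ψ (Matrix.vecCons x Y)‖₊ : ℝ≥0∞) ^ 2 := by
    push_cast
    rfl
  rw [hocc, mul_pow]
  gcongr

end L1b

section LFT
open scoped InnerProductSpace
/-! ### The abstract transfer inequality in a complex inner product space -/

section Hilbert

variable {E : Type*} [NormedAddCommGroup E] [InnerProductSpace ℂ E]

/-- For unit vectors `u, w`, the residual `r = u - ⟨w, u⟩ w` of the orthogonal projection of `u`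
on `w` has `‖r‖² = 1 - |⟨w, u⟩|²`. [folklore] -/
theorem ft_norm_sub_proj_sq (u w : E) (hu : ‖u‖ = 1) (hw : ‖w‖ = 1) :
    ‖u - ⟪w, u⟫_ℂ • w‖ ^ 2 = 1 - ‖⟪w, u⟫_ℂ‖ ^ 2 := by
  have hre : RCLike.re (⟪w, u⟫_ℂ * conj ⟪w, u⟫_ℂ) = ‖⟪w, u⟫_ℂ‖ ^ 2 := by
    rw [Complex.mul_conj', ← Complex.ofReal_pow, RCLike.re_to_complex, Complex.ofReal_re]
  rw [norm_sub_sq (𝕜 := ℂ), inner_smul_right, ← inner_conj_symm u w, hre, norm_smul, hu, hw]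
  ring

/-- **Alignment through a near-parallel pair** (unit vectors `e, u, w`):
`|⟨e, u⟩| ≥ |⟨w, u⟩| |⟨e, w⟩| - ‖u - ⟨w, u⟩ w‖` — decompose `u = ⟨w, u⟩ w + r` and use
Cauchy–Schwarz on `⟨e, r⟩`. [folklore] -/
theorem ft_norm_inner_ge (e u w : E) (he : ‖e‖ = 1) :
    ‖⟪w, u⟫_ℂ‖ * ‖⟪e, w⟫_ℂ‖ - ‖u - ⟪w, u⟫_ℂ • w‖ ≤ ‖⟪e, u⟫_ℂ‖ := by
  have hdec : ⟪e, u⟫_ℂ = ⟪w, u⟫_ℂ * ⟪e, w⟫_ℂ + ⟪e, u - ⟪w, u⟫_ℂ • w⟫_ℂ := by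
    rw [inner_sub_right, inner_smul_right]
    ring
  have h1 : ‖⟪w, u⟫_ℂ * ⟪e, w⟫_ℂ‖ ≤ ‖⟪e, u⟫_ℂ‖ + ‖⟪e, u - ⟪w, u⟫_ℂ • w⟫_ℂ‖ := by
    rw [hdec]
    exact norm_le_add_norm_add _ _
  have h2 : ‖⟪e, u - ⟪w, u⟫_ℂ • w⟫_ℂ‖ ≤ ‖u - ⟪w, u⟫_ℂ • w‖ := by
    calc ‖⟪e, u - ⟪w, u⟫_ℂ • w⟫_ℂ‖ ≤ ‖e‖ * ‖u - ⟪w, u⟫_ℂ • w‖ := norm_inner_le_norm _ _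
      _ = ‖u - ⟪w, u⟫_ℂ • w‖ := by rw [he, one_mul]
  rw [norm_mul] at h1
  linarith

/-- **Flatness transfer, unit vectors**: if `|⟨e, w⟩|² ≥ κ` and `|⟨w, u⟩|² ≥ 1 - κ/16`
(`0 ≤ κ ≤ 1`, `e, u, w` unit vectors), then `|⟨e, u⟩|² ≥ κ/4`. [folklore] -/
theorem ft_unit_transfer (e u w : E) (he : ‖e‖ = 1) (hu : ‖u‖ = 1) (hw : ‖w‖ = 1) {κ : ℝ}
    (hκ0 : 0 ≤ κ) (hκ1 : κ ≤ 1) (h1 : κ ≤ ‖⟪e, w⟫_ℂ‖ ^ 2) (h2 : 1 - κ / 16 ≤ ‖⟪w, u⟫_ℂ‖ ^ 2) :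
    κ / 4 ≤ ‖⟪e, u⟫_ℂ‖ ^ 2 := by
  have hA := ft_norm_inner_ge e u w he
  have hs := ft_norm_sub_proj_sq u w hu hw
  set p := ‖⟪w, u⟫_ℂ‖ with hp
  set q := ‖⟪e, w⟫_ℂ‖ with hq
  set a := ‖⟪e, u⟫_ℂ‖ with ha
  set s := ‖u - ⟪w, u⟫_ℂ • w‖ with hs'
  have hp0 : 0 ≤ p := norm_nonneg _
  have hq0 : 0 ≤ q := norm_nonneg _
  have hs2 : s ^ 2 ≤ κ / 16 := by rw [hs]; linarith
  have hκ2 : κ * κ ≤ κ * 1 := mul_le_mul_of_nonneg_left hκ1 hκ0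
  have hpq2 : 15 * κ / 16 ≤ (p * q) ^ 2 := by
    rw [mul_pow]
    calc 15 * κ / 16 ≤ (1 - κ / 16) * κ := by nlinarith
      _ ≤ p ^ 2 * q ^ 2 := mul_le_mul h2 h1 hκ0 (sq_nonneg _)
  have h3s : 3 * s ≤ p * q := by
    have h9 : (3 * s) ^ 2 ≤ (p * q) ^ 2 := by nlinarith
    exact (abs_le_of_sq_le_sq' h9 (mul_nonneg hp0 hq0)).2
  have h23 : 2 * (p * q) / 3 ≤ a := by linarith
  have hsq : (2 * (p * q) / 3) ^ 2 ≤ a ^ 2 :=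
    pow_le_pow_left₀ (by positivity) h23 2
  nlinarith

/-- **Flatness transfer** (nonzero `f, g`, unit `e`): if `|⟨e, g⟩|²/‖g‖² ≥ κ` and
`|⟨g, f⟩|²/(‖g‖² ‖f‖²) ≥ 1 - κ/16` (`0 ≤ κ ≤ 1`), then `|⟨e, f⟩|²/‖f‖² ≥ κ/4` — the unit-vector
statement for `u = f/‖f‖`, `w = g/‖g‖`. [folklore] -/
theorem ft_transfer (e f g : E) (he : ‖e‖ = 1) (hf : f ≠ 0) (hg : g ≠ 0) {κ : ℝ} (hκ0 : 0 ≤ κ)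
    (hκ1 : κ ≤ 1) (h1 : κ ≤ ‖⟪e, g⟫_ℂ‖ ^ 2 / ‖g‖ ^ 2)
    (h2 : 1 - κ / 16 ≤ ‖⟪g, f⟫_ℂ‖ ^ 2 / (‖g‖ ^ 2 * ‖f‖ ^ 2)) :
    κ / 4 ≤ ‖⟪e, f⟫_ℂ‖ ^ 2 / ‖f‖ ^ 2 := by
  have hf0 : 0 < ‖f‖ := norm_pos_iff.mpr hf
  have hg0 : 0 < ‖g‖ := norm_pos_iff.mpr hg
  set u : E := ((‖f‖⁻¹ : ℝ) : ℂ) • f with hu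
  set w : E := ((‖g‖⁻¹ : ℝ) : ℂ) • g with hw
  have hnu : ‖u‖ = 1 := by
    rw [hu, norm_smul, Complex.norm_real, norm_inv, norm_norm, inv_mul_cancel₀ hf0.ne']
  have hnw : ‖w‖ = 1 := by
    rw [hw, norm_smul, Complex.norm_real, norm_inv, norm_norm, inv_mul_cancel₀ hg0.ne']
  have heu : ‖⟪e, u⟫_ℂ‖ ^ 2 = ‖⟪e, f⟫_ℂ‖ ^ 2 / ‖f‖ ^ 2 := by
    rw [hu, inner_smul_right, norm_mul, Complex.norm_real, norm_inv, norm_norm, mul_pow, inv_pow,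
      inv_mul_eq_div]
  have hew : ‖⟪e, w⟫_ℂ‖ ^ 2 = ‖⟪e, g⟫_ℂ‖ ^ 2 / ‖g‖ ^ 2 := by
    rw [hw, inner_smul_right, norm_mul, Complex.norm_real, norm_inv, norm_norm, mul_pow, inv_pow,
      inv_mul_eq_div]
  have hwu : ‖⟪w, u⟫_ℂ‖ ^ 2 = ‖⟪g, f⟫_ℂ‖ ^ 2 / (‖g‖ ^ 2 * ‖f‖ ^ 2) := by
    rw [hu, hw, inner_smul_left, inner_smul_right, Complex.conj_ofReal, norm_mul, norm_mul,
      Complex.norm_real, Complex.norm_real, norm_inv, norm_inv, norm_norm, norm_norm]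
    field_simp
  rw [← heu]
  rw [← hew] at h1
  rw [← hwu] at h2
  exact ft_unit_transfer e u w he hnu hnw hκ0 hκ1 h1 h2

end Hilbert

/-! ### From `L²` functions to the Hilbert space `Lp ℂ 2` -/

section LTwo

variable {α : Type*} [MeasurableSpace α] {μ : Measure α}

/-- `∫ |f|² = ‖f‖_{L²}²` in `ℝ≥0∞` (the `lintegral` of `‖f‖₊²` is the square of `eLpNorm f 2`).
[folklore] -/
theorem ft_lintegral_sq_eq_eLpNorm_sq (f : α → ℂ) :
    ∫⁻ a, (‖f a‖₊ : ℝ≥0∞) ^ 2 ∂μ = eLpNorm f 2 μ ^ 2 := by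
  rw [eLpNorm_eq_eLpNorm' two_ne_zero ENNReal.ofNat_ne_top, ENNReal.toReal_ofNat,
    ← ENNReal.rpow_two, ← lintegral_rpow_enorm_eq_rpow_eLpNorm' zero_lt_two]
  refine lintegral_congr fun a => ?_
  rw [ENNReal.rpow_two, enorm_eq_nnnorm]

/-- An a.e.-strongly measurable `f` with `∫ |f|² < ∞` is in `L²`. [folklore] -/
theorem ft_memLp_two {f : α → ℂ} (hf : AEStronglyMeasurable f μ)
    (h2 : ∫⁻ a, (‖f a‖₊ : ℝ≥0∞) ^ 2 ∂μ ≠ ⊤) : MemLp f 2 μ := by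
  refine ⟨hf, ?_⟩
  have h : eLpNorm f 2 μ ^ 2 < ⊤ := by
    rw [← ft_lintegral_sq_eq_eLpNorm_sq]
    exact h2.lt_top
  exact (ENNReal.pow_lt_top_iff.1 h).resolve_right two_ne_zero

/-- `‖f‖_{L²}² = (∫ |f|²).toReal` for the class of `f` in `Lp ℂ 2`. [folklore] -/
theorem ft_norm_toLp_sq {f : α → ℂ} (hf : MemLp f 2 μ) :
    ‖hf.toLp f‖ ^ 2 = (∫⁻ a, (‖f a‖₊ : ℝ≥0∞) ^ 2 ∂μ).toReal := by
  rw [Lp.norm_toLp, ← ENNReal.toReal_pow, ft_lintegral_sq_eq_eLpNorm_sq]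

/-- The `L²` inner product of two classes is the pairing `∫ conj f · g`. [folklore] -/
theorem ft_inner_toLp {f g : α → ℂ} (hf : MemLp f 2 μ) (hg : MemLp g 2 μ) :
    ⟪hf.toLp f, hg.toLp g⟫_ℂ = ∫ a, conj (f a) * g a ∂μ := by
  rw [L2.inner_def]
  refine integral_congr_ae ?_
  filter_upwards [hf.coeFn_toLp, hg.coeFn_toLp] with a ha hb
  rw [ha, hb, RCLike.inner_apply']

/-- Conversion of the `ℝ≥0∞`-valued ratio bound `ofReal r ≤ |z|² / B` (`B ≠ 0`) to the real
inequality `r ≤ |z|² / B.toReal` (both sides read `r ≤ 0` if `B = ∞`). [folklore] -/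
theorem ft_ofReal_le_div_iff {r : ℝ} {z : ℂ} {B : ℝ≥0∞} (hB0 : B ≠ 0) :
    ENNReal.ofReal r ≤ (‖z‖₊ : ℝ≥0∞) ^ 2 / B ↔ r ≤ ‖z‖ ^ 2 / B.toReal := by
  rw [ENNReal.ofReal_le_iff_le_toReal
      (ENNReal.div_ne_top (ENNReal.pow_ne_top ENNReal.coe_ne_top) hB0),
    ENNReal.toReal_div, ENNReal.toReal_pow, ENNReal.coe_toReal, coe_nnnorm]

/-- **Flatness transfer for `L²` functions** (`e` normalised, `f, g ∈ L²`, all ratios in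
`ℝ≥0∞`): `κ ≤ |⟨e, g⟩|²/‖g‖²` and `1 - κ/16 ≤ |⟨g, f⟩|²/(‖g‖² ‖f‖²)` imply
`κ/4 ≤ |⟨e, f⟩|²/‖f‖²` (`0 ≤ κ ≤ 1`). The second hypothesis forces `⟨g, f⟩ ≠ 0`, hence
`f, g ≠ 0` in `L²`, and the statement is `ft_transfer` in `Lp ℂ 2 μ`. [folklore] -/
theorem ft_functions {e f g : α → ℂ} (he : AEStronglyMeasurable e μ)
    (hf : AEStronglyMeasurable f μ) (hg : AEStronglyMeasurable g μ)
    (he1 : ∫⁻ a, (‖e a‖₊ : ℝ≥0∞) ^ 2 ∂μ = 1) (hf2 : ∫⁻ a, (‖f a‖₊ : ℝ≥0∞) ^ 2 ∂μ ≠ ⊤)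
    (hg2 : ∫⁻ a, (‖g a‖₊ : ℝ≥0∞) ^ 2 ∂μ ≠ ⊤) {κ : ℝ} (hκ0 : 0 ≤ κ) (hκ1 : κ ≤ 1)
    (h1 : ENNReal.ofReal κ ≤
      (‖∫ a, conj (e a) * g a ∂μ‖₊ : ℝ≥0∞) ^ 2 / ∫⁻ a, (‖g a‖₊ : ℝ≥0∞) ^ 2 ∂μ)
    (h2 : ENNReal.ofReal (1 - κ / 16) ≤
      (‖∫ a, conj (g a) * f a ∂μ‖₊ : ℝ≥0∞) ^ 2 /
        ((∫⁻ a, (‖g a‖₊ : ℝ≥0∞) ^ 2 ∂μ) * ∫⁻ a, (‖f a‖₊ : ℝ≥0∞) ^ 2 ∂μ)) :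
    ENNReal.ofReal (κ / 4) ≤
      (‖∫ a, conj (e a) * f a ∂μ‖₊ : ℝ≥0∞) ^ 2 / ∫⁻ a, (‖f a‖₊ : ℝ≥0∞) ^ 2 ∂μ := by
  -- lift to `L²`
  have heL : MemLp e 2 μ := ft_memLp_two he (by rw [he1]; exact ENNReal.one_ne_top)
  have hfL : MemLp f 2 μ := ft_memLp_two hf hf2
  have hgL : MemLp g 2 μ := ft_memLp_two hg hg2
  have hEn : ‖heL.toLp e‖ = 1 := by
    have h := ft_norm_toLp_sq heL
    rw [he1, ENNReal.toReal_one] at h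
    rw [← Real.sqrt_sq (norm_nonneg (heL.toLp e)), h, Real.sqrt_one]
  have hFn := ft_norm_toLp_sq hfL
  have hGn := ft_norm_toLp_sq hgL
  have hEF := ft_inner_toLp heL hfL
  have hEG := ft_inner_toLp heL hgL
  have hGF := ft_inner_toLp hgL hfL
  -- non-degeneracy: `⟨g, f⟩ ≠ 0`
  have hGF0 : ⟪hgL.toLp g, hfL.toLp f⟫_ℂ ≠ 0 := by
    intro h0
    have hpos : 0 < ENNReal.ofReal (1 - κ / 16) := ENNReal.ofReal_pos.2 (by linarith)
    refine (ENNReal.div_pos_iff.1 (hpos.trans_le h2)).1 ?_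
    rw [← hGF, h0, nnnorm_zero, ENNReal.coe_zero, zero_pow two_ne_zero]
  have hF0 : hfL.toLp f ≠ 0 := fun h => hGF0 (by rw [h, inner_zero_right])
  have hG0 : hgL.toLp g ≠ 0 := fun h => hGF0 (by rw [h, inner_zero_left])
  have hf0 : ∫⁻ a, (‖f a‖₊ : ℝ≥0∞) ^ 2 ∂μ ≠ 0 := by
    intro h
    have hn : 0 < ‖hfL.toLp f‖ ^ 2 := pow_pos (norm_pos_iff.mpr hF0) 2
    rw [hFn, h, ENNReal.toReal_zero] at hn
    exact lt_irrefl _ hn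
  have hg0 : ∫⁻ a, (‖g a‖₊ : ℝ≥0∞) ^ 2 ∂μ ≠ 0 := by
    intro h
    have hn : 0 < ‖hgL.toLp g‖ ^ 2 := pow_pos (norm_pos_iff.mpr hG0) 2
    rw [hGn, h, ENNReal.toReal_zero] at hn
    exact lt_irrefl _ hn
  -- convert to real inequalities and apply the abstract transfer
  rw [ft_ofReal_le_div_iff hf0, ← hFn, ← hEF]
  rw [ft_ofReal_le_div_iff hg0, ← hGn, ← hEG] at h1
  rw [ft_ofReal_le_div_iff (mul_ne_zero hg0 hf0), ENNReal.toReal_mul, ← hGn, ← hFn, ← hGF] at h2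
  exact ft_transfer _ _ _ hEn hF0 hG0 hκ0 hκ1 h1 h2

end LTwo

/-! ### The registered stub -/

/-- **Stub `stub_flatnessTransfer`** of line `entropy-swap` (crux `PeriodicToDirichlet`): the
conditional flatness `κ(f) = |⟨φ₀, f⟩|²/‖f‖²` (`φ₀ = constantMode L`) of the slice
`f = F(· :: Y)` is at least `κ/4` as soon as the slice `g = G(· :: Y)` has flatness `≥ κ` and
the two slices overlap to `|⟨g, f⟩|²/(‖g‖² ‖f‖²) ≥ 1 - κ/16` (`0 ≤ κ ≤ 1`; slices measurable and
in `L²`, `L > 0`). [folklore] -/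
theorem stub_flatnessTransfer :
    ∀ (n : ℕ) (L : ℝ) (G F : Config (n + 1) → ℂ) (Y : Config n), Measurable G → Measurable F →
      0 < L →
      (∫⁻ x, (‖G (Matrix.vecCons x Y)‖₊ : ℝ≥0∞) ^ 2) ≠ ⊤ →
      (∫⁻ x, (‖F (Matrix.vecCons x Y)‖₊ : ℝ≥0∞) ^ 2) ≠ ⊤ →
      ∀ κ : ℝ, 0 ≤ κ → κ ≤ 1 →
        ENNReal.ofReal κ ≤
          (‖∫ x, (starRingEnd ℂ) (constantMode L x) * G (Matrix.vecCons x Y)‖₊ : ℝ≥0∞) ^ 2 /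
            ∫⁻ x, (‖G (Matrix.vecCons x Y)‖₊ : ℝ≥0∞) ^ 2 →
        ENNReal.ofReal (1 - κ / 16) ≤
          (‖∫ x, (starRingEnd ℂ) (G (Matrix.vecCons x Y)) * F (Matrix.vecCons x Y)‖₊ : ℝ≥0∞) ^ 2 /
            ((∫⁻ x, (‖G (Matrix.vecCons x Y)‖₊ : ℝ≥0∞) ^ 2) *
              ∫⁻ x, (‖F (Matrix.vecCons x Y)‖₊ : ℝ≥0∞) ^ 2) →
        ENNReal.ofReal (κ / 4) ≤
          (‖∫ x, (starRingEnd ℂ) (constantMode L x) * F (Matrix.vecCons x Y)‖₊ : ℝ≥0∞) ^ 2 /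
            ∫⁻ x, (‖F (Matrix.vecCons x Y)‖₊ : ℝ≥0∞) ^ 2 := by
  intro n L G F Y hG hF hL hG2 hF2 κ hκ0 hκ1 h1 h2
  exact ft_functions (aestronglyMeasurable_constantMode L)
    (measurable_comp_vecCons_left hF Y).aestronglyMeasurable
    (measurable_comp_vecCons_left hG Y).aestronglyMeasurable (lintegral_constantMode_sq hL)
    hF2 hG2 hκ0 hκ1 h1 h2

end LFT

end Landed

/-! ### Objects -/

/-- Bath law of an `(n+1)`-body wave function: the measure on `Config n` with Lebesgue density
`Y ↦ ∫ |Ψ(x :: Y)|² dx` (first particle integrated out). -/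
def bathMeasure (n : ℕ) (Ψ : Config (n + 1) → ℂ) : Measure (Config n) :=
  volume.withDensity fun Y => ∫⁻ x, (‖Ψ (Matrix.vecCons x Y)‖₊ : ℝ≥0∞) ^ 2

/-- Conditional overlap `σ_Ψ(Y, Y') = |⟨ψ_{Y'}, ψ_Y⟩|² / (‖ψ_Y‖² ‖ψ_{Y'}‖²)` of the slices
`ψ_Y = Ψ(·, Y)` (`0/0 = 0`). -/
def condOverlap (n : ℕ) (Ψ : Config (n + 1) → ℂ) (Y Y' : Config n) : ℝ≥0∞ :=
  (‖∫ x, conj (Ψ (Matrix.vecCons x Y')) * Ψ (Matrix.vecCons x Y)‖₊ : ℝ≥0∞) ^ 2 /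
    ((∫⁻ x, (‖Ψ (Matrix.vecCons x Y)‖₊ : ℝ≥0∞) ^ 2) *
      ∫⁻ x, (‖Ψ (Matrix.vecCons x Y')‖₊ : ℝ≥0∞) ^ 2)

/-- A real torus function cut to the fundamental cell and read as a complex wave function. -/
def cellState (n : ℕ) (L : ℝ) (Φ : Config (n + 1) → ℝ) : Config (n + 1) → ℂ :=
  (cellN (n + 1) L).indicator fun X => (Φ X : ℂ)

/-- **Conditional flatness** of the slice `ψ_Y = Ψ(·, Y)`: `κ_Ψ(Y) = |⟨φ₀, ψ_Y⟩|² / ‖ψ_Y‖²`,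
`φ₀ = constantMode L` (`0/0 = 0`). Its `Q`-mean is `n₀(Ψ)/N`. -/
def condFlatness (n : ℕ) (L : ℝ) (Ψ : Config (n + 1) → ℂ) (Y : Config n) : ℝ≥0∞ :=
  (‖∫ x, conj (constantMode L x) * Ψ (Matrix.vecCons x Y)‖₊ : ℝ≥0∞) ^ 2 /
    ∫⁻ x, (‖Ψ (Matrix.vecCons x Y)‖₊ : ℝ≥0∞) ^ 2

/-- **Mixed conditional overlap** of the slices of two wave functions at the SAME bath:
`τ(Y) = |⟨g_Y, f_Y⟩|² / (‖g_Y‖² ‖f_Y‖²)` (`0/0 = 0`). -/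
def mixedOverlap (n : ℕ) (G F : Config (n + 1) → ℂ) (Y : Config n) : ℝ≥0∞ :=
  (‖∫ x, conj (G (Matrix.vecCons x Y)) * F (Matrix.vecCons x Y)‖₊ : ℝ≥0∞) ^ 2 /
    ((∫⁻ x, (‖G (Matrix.vecCons x Y)‖₊ : ℝ≥0∞) ^ 2) * ∫⁻ x, (‖F (Matrix.vecCons x Y)‖₊ : ℝ≥0∞) ^ 2)

/-- The consequent of `A = PeriodicBEC` at one potential `v`. -/
def PeriodicBECAt (v : ℝ → ℝ≥0∞) : Prop :=
  ∃ ρ₀ : ℝ, 0 < ρ₀ ∧ ∀ ρ : ℝ, 0 < ρ → ρ < ρ₀ → ∃ c : ℝ, 0 < c ∧ ∀ᶠ N : ℕ in atTop,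
    ∃ δ : ℝ≥0∞, 0 < δ ∧ ∀ Ψ : PeriodicTrialState N (sideLength ρ N),
      periodicEnergy v Ψ ≤ periodicGroundStateEnergy v N (sideLength ρ N) + δ →
        ENNReal.ofReal (c * N) ≤ condensateOccupation N (sideLength ρ N) Ψ.ψ

example : BECPeriodicReduction.PeriodicBEC = ∀ v, IsRepulsiveFiniteRange v → PeriodicBECAt v := rfl

/-! ### Named statements of the line -/

/-- (stub 1a, provable now, L) `A` reaches the torus GROUND STATE: for bounded admissible `v`, the
`A`-floor `n₀ ≥ cN` on `δ`-near-minimisers passes to the Feynman–Kac ground state `Φ` of the torus of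
side `L_N(ρ)` (two-level/Ky Fan gap ⇒ near-minimisers are `L²(cell)`-close to `Φ` up to a phase, tree:
`IsPeriodicGroundStateFK.exists_twoLevel`, `ofReal_le_periodicEnergy_of_twoLevel`; `n₀` is `2N√η`-Lipschitz,
`condensateOccupation_le_add_of_sq_dist_le`; template `TorusInterfaceBounded.lean`). -/
def TorusCondensateFloor : Prop :=
  ∀ v : ℝ → ℝ≥0∞, IsRepulsiveFiniteRange v → (∃ B : ℝ≥0, ∀ r, 0 ≤ r → v r ≤ B) → PeriodicBECAt v →
    ∃ ρ₁ : ℝ, 0 < ρ₁ ∧ ∀ ρ : ℝ, 0 < ρ → ρ < ρ₁ → ∃ c : ℝ, 0 < c ∧ ∀ᶠ n : ℕ in atTop,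
      ∀ Φ : Config (n + 1) → ℝ, IsPeriodicGroundStateFK v (sideLength ρ (n + 1)) Φ → Continuous Φ →
        ENNReal.ofReal (c * (n + 1)) ≤
          condensateOccupation (n + 1) (sideLength ρ (n + 1)) (fun X => (Φ X : ℂ))

/-- (stub 1b, provable now, M) Cauchy–Schwarz `⟨φ, ρ₁ φ⟩² ≤ tr ρ₁²` operator-free:
`occupation(φ)² ≤ N² · swapPurity` for a sub-normalised mode `φ` and `Ψ ∈ L²`. -/
def OccupationSqLeSwapPurity : Prop :=
  ∀ (n : ℕ) (φ : Space → ℂ) (Ψ : Config (n + 1) → ℂ), Measurable φ → Measurable Ψ →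
    (∫⁻ x, (‖φ x‖₊ : ℝ≥0∞) ^ 2) ≤ 1 → (∫⁻ X, (‖Ψ X‖₊ : ℝ≥0∞) ^ 2) ≠ ⊤ →
      occupation (n + 1) φ Ψ ^ 2 ≤ ((n + 1 : ℕ) : ℝ≥0∞) ^ 2 * swapPurity n Ψ

/-- (stub 2, provable now, M) Disintegration of the swap purity over two independent baths:
`swapPurity = E_{Q⊗Q}[σ_Ψ]` for `Ψ ∈ L²` (Tonelli; `withDensity` unfolds the denominators a.e.). -/
def SwapPurityDisintegration : Prop :=
  ∀ (n : ℕ) (Ψ : Config (n + 1) → ℂ), Measurable Ψ → (∫⁻ X, (‖Ψ X‖₊ : ℝ≥0∞) ^ 2) ≠ ⊤ →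
    swapPurity n Ψ = ∫⁻ Y, ∫⁻ Y', condOverlap n Ψ Y Y' ∂(bathMeasure n Ψ) ∂(bathMeasure n Ψ)

/-- (stub 3 = R1, research) ENTROPY BUDGET OF THE WALL at `m = 0`: the bath law of every Dirichlet
`δ`-near-minimiser of the box of side `ℓ = L_N(ρ)` is within `o(N)` Kullback–Leibler divergence of the
bath law of the torus ground state of the same `N` particles on the torus of side `ℓ` (cell = box).
Bounded `v` with `∫ v > 0` (false at `v = 0`: `KL = 3(1 - log 2)N`). -/
def EntropyBudget : Prop :=
  ∀ v : ℝ → ℝ≥0∞, IsRepulsiveFiniteRange v → (∃ B : ℝ≥0, ∀ r, 0 ≤ r → v r ≤ B) →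
    (∫⁻ x : Space, v ‖x‖) ≠ 0 →
    ∃ ρ₁ : ℝ, 0 < ρ₁ ∧ ∀ ρ : ℝ, 0 < ρ → ρ < ρ₁ → ∀ ε : ℝ, 0 < ε → ∀ᶠ n : ℕ in atTop,
      ∃ δ : ℝ≥0∞, 0 < δ ∧
        ∀ Φ : Config (n + 1) → ℝ, IsPeriodicGroundStateFK v (sideLength ρ (n + 1)) Φ →
          Continuous Φ → (∀ X, 0 < Φ X) →
        ∀ Ψ : TrialState (n + 1) (sideLength ρ (n + 1)),
          energy v Ψ ≤ groundStateEnergy v (n + 1) (sideLength ρ (n + 1)) + δ →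
            klDiv (bathMeasure n Ψ.ψ) (bathMeasure n (cellState n (sideLength ρ (n + 1)) Φ)) ≤
              ENNReal.ofReal (ε * (n + 1))

/-- (stub 4 = R2, research) TORUS OVERLAP CONCENTRATION at speed `N`: under two independent baths drawn
from the torus ground state, the conditional overlap falls below the fraction `θ` of its mean only with
probability `≤ e^{-gN}`. -/
def TorusOverlapConcentration : Prop :=
  ∀ v : ℝ → ℝ≥0∞, IsRepulsiveFiniteRange v → (∃ B : ℝ≥0, ∀ r, 0 ≤ r → v r ≤ B) →
    ∃ ρ₁ : ℝ, 0 < ρ₁ ∧ ∀ ρ : ℝ, 0 < ρ → ρ < ρ₁ → ∀ θ : ℝ, 0 < θ → θ < 1 →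
      ∃ g : ℝ, 0 < g ∧ ∀ᶠ n : ℕ in atTop,
        ∀ Φ : Config (n + 1) → ℝ, IsPeriodicGroundStateFK v (sideLength ρ (n + 1)) Φ →
          Continuous Φ → (∀ X, 0 < Φ X) →
          let Φc := cellState n (sideLength ρ (n + 1)) Φ
          let P := bathMeasure n Φc
          (P.prod P) {p | condOverlap n Φc p.1 p.2 <
              ENNReal.ofReal θ * ∫⁻ q, condOverlap n Φc q.1 q.2 ∂(P.prod P)} ≤
            ENNReal.ofReal (Real.exp (-(g * (n + 1))))

/-- (stub 5 = R3, research; quantifiers `∃ κ ∀ ε`) OVERLAP STABILITY under the wall's Doob factor: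
in `Q⊗Q`-measure the conditional overlaps of a Dirichlet near-minimiser dominate `κ ×` those of the
torus ground state up to `ε`, off a set of mass `ε`. -/
def OverlapStability : Prop :=
  ∀ v : ℝ → ℝ≥0∞, IsRepulsiveFiniteRange v → (∃ B : ℝ≥0, ∀ r, 0 ≤ r → v r ≤ B) →
    (∫⁻ x : Space, v ‖x‖) ≠ 0 →
    ∃ ρ₁ : ℝ, 0 < ρ₁ ∧ ∀ ρ : ℝ, 0 < ρ → ρ < ρ₁ → ∃ κ : ℝ, 0 < κ ∧ ∀ ε : ℝ, 0 < ε →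
      ∀ᶠ n : ℕ in atTop, ∃ δ : ℝ≥0∞, 0 < δ ∧
        ∀ Φ : Config (n + 1) → ℝ, IsPeriodicGroundStateFK v (sideLength ρ (n + 1)) Φ →
          Continuous Φ → (∀ X, 0 < Φ X) →
        ∀ Ψ : TrialState (n + 1) (sideLength ρ (n + 1)),
          energy v Ψ ≤ groundStateEnergy v (n + 1) (sideLength ρ (n + 1)) + δ →
            let Φc := cellState n (sideLength ρ (n + 1)) Φ
            let Q := bathMeasure n Ψ.ψ
            (Q.prod Q) {p | condOverlap n Ψ.ψ p.1 p.2 + ENNReal.ofReal ε <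
                ENNReal.ofReal κ * condOverlap n Φc p.1 p.2} ≤ ENNReal.ofReal ε

/-- (R2′, research) **Torus flatness concentration**: under the bath law of the torus ground state,
the conditional flatness falls below the fraction `θ` of its mean only with probability `e^{-gN}`. -/
def TorusFlatnessConcentration : Prop :=
  ∀ v : ℝ → ℝ≥0∞, IsRepulsiveFiniteRange v → (∃ B : ℝ≥0, ∀ r, 0 ≤ r → v r ≤ B) →
    ∃ ρ₁ : ℝ, 0 < ρ₁ ∧ ∀ ρ : ℝ, 0 < ρ → ρ < ρ₁ → ∀ θ : ℝ, 0 < θ → θ < 1 →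
      ∃ g : ℝ, 0 < g ∧ ∀ᶠ n : ℕ in atTop,
        ∀ Φ : Config (n + 1) → ℝ, IsPeriodicGroundStateFK v (sideLength ρ (n + 1)) Φ →
          Continuous Φ → (∀ X, 0 < Φ X) →
          let Φc := cellState n (sideLength ρ (n + 1)) Φ
          let P := bathMeasure n Φc
          P {Y | condFlatness n (sideLength ρ (n + 1)) Φc Y <
              ENNReal.ofReal θ * ∫⁻ Y', condFlatness n (sideLength ρ (n + 1)) Φc Y' ∂P} ≤
            ENNReal.ofReal (Real.exp (-(g * (n + 1))))

/-- (R3″, research) **Slice alignment**: for `Q`-most baths `Y`, the Dirichlet near-minimiser's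
slice `Ψ(·,Y)` is `L²`-aligned up to a phase with the torus ground state's slice `Φ(·,Y)`:
`|cos ∠|² ≥ 1 - η` off a set of `Q`-mass `≤ η`. -/
def SliceAlignment : Prop :=
  ∀ v : ℝ → ℝ≥0∞, IsRepulsiveFiniteRange v → (∃ B : ℝ≥0, ∀ r, 0 ≤ r → v r ≤ B) →
    (∫⁻ x : Space, v ‖x‖) ≠ 0 →
    ∃ ρ₁ : ℝ, 0 < ρ₁ ∧ ∀ ρ : ℝ, 0 < ρ → ρ < ρ₁ → ∀ η : ℝ, 0 < η →
      ∀ᶠ n : ℕ in atTop, ∃ δ : ℝ≥0∞, 0 < δ ∧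
        ∀ Φ : Config (n + 1) → ℝ, IsPeriodicGroundStateFK v (sideLength ρ (n + 1)) Φ →
          Continuous Φ → (∀ X, 0 < Φ X) →
        ∀ Ψ : TrialState (n + 1) (sideLength ρ (n + 1)),
          energy v Ψ ≤ groundStateEnergy v (n + 1) (sideLength ρ (n + 1)) + δ →
            bathMeasure n Ψ.ψ {Y | mixedOverlap n (cellState n (sideLength ρ (n + 1)) Φ) Ψ.ψ Y <
                ENNReal.ofReal (1 - η)} ≤ ENNReal.ofReal η

/-- (provable now, M) **Flatness transfer** — the Hilbert-space inequality
`√κ(f) ≥ √(τ κ(g)) − √(1 − τ)` for slices `f, g` with mixed overlap `τ` (decompose the unit vector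
`f/‖f‖` along `g/‖g‖` and its orthogonal complement), with constants baked in:
`κ(g) ≥ κ`, `τ ≥ 1 − κ/16`, `κ ≤ 1` ⇒ `κ(f) ≥ κ/4` (since `√(15κ/16) − √κ/4 ≥ √κ/2`). -/
def FlatnessTransfer : Prop :=
  ∀ (n : ℕ) (L : ℝ) (G F : Config (n + 1) → ℂ) (Y : Config n), Measurable G → Measurable F →
    0 < L →
    (∫⁻ x, (‖G (Matrix.vecCons x Y)‖₊ : ℝ≥0∞) ^ 2) ≠ ⊤ →
    (∫⁻ x, (‖F (Matrix.vecCons x Y)‖₊ : ℝ≥0∞) ^ 2) ≠ ⊤ →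
    ∀ κ : ℝ, 0 ≤ κ → κ ≤ 1 →
      ENNReal.ofReal κ ≤ condFlatness n L G Y →
      ENNReal.ofReal (1 - κ / 16) ≤ mixedOverlap n G F Y →
        ENNReal.ofReal (κ / 4) ≤ condFlatness n L F Y

/-- What the Yau chain delivers: dilute ground-state BEC for every BOUNDED, not a.e.-trivial,
admissible `v`. -/
def BoundedNontrivialBEC : Prop :=
  ∀ v : ℝ → ℝ≥0∞, IsRepulsiveFiniteRange v → (∃ B : ℝ≥0, ∀ r, 0 ≤ r → v r ≤ B) →
    (∫⁻ x : Space, v ‖x‖) ≠ 0 →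
      ∃ ρ₀ : ℝ, 0 < ρ₀ ∧ ∀ ρ : ℝ, 0 < ρ → ρ < ρ₀ → HasGroundStateBEC v ρ

/-- THE YAU CHAIN (glue, proved below as `assembly`): the six inputs and `A` give
`BoundedNontrivialBEC` (entropy–event bound, KL tensorisation, Markov, Penrose–Onsager
`N·swapPurity ≤ λ_max`, `le_condensateNumber`, existence of the torus FK ground state
`PeriodicGroundStateFeynmanKac_holds`). -/
def Assembly : Prop :=
  TorusCondensateFloor → OccupationSqLeSwapPurity → SwapPurityDisintegration → EntropyBudget →
    TorusOverlapConcentration → OverlapStability → BECPeriodicReduction.PeriodicBEC →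
      BoundedNontrivialBEC

/-- THE ONE-BATH CHAIN (design II, glue `boundedNontrivialBEC_of_oneBath`): flatness instead of
swap purity — `A` gives `E_P κ_Φ ≥ c'` (stub 1a + one-bath disintegration), R2′ and R1 make
`{κ_Φ < c'/2}` `Q`-rare, R3″ + the flatness transfer give `κ_Ψ ≥ c'/8` on a `Q`-large set, hence the
FLAT-MODE occupation of every near-minimiser is `≥ (c'/16)N`. -/
def AssemblyII : Prop :=
  TorusCondensateFloor → FlatnessTransfer → EntropyBudget → TorusFlatnessConcentration →
    SliceAlignment → BECPeriodicReduction.PeriodicBEC → BoundedNontrivialBEC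

/-! ### Registered stubs (signatures over tree vocabulary) -/

/-- **Stub 1a** (LANDED p111290, `Theorems/BECThomsonPrinciplePeriodicToDirichletTorusCondensateFloor.lean`):
`A` reaches the torus Feynman–Kac ground state. -/
theorem stub_torusCondensateFloor :
    ∀ v : ℝ → ℝ≥0∞, IsRepulsiveFiniteRange v → (∃ B : ℝ≥0, ∀ r, 0 ≤ r → v r ≤ B) →
      (∃ ρ₀ : ℝ, 0 < ρ₀ ∧ ∀ ρ : ℝ, 0 < ρ → ρ < ρ₀ → ∃ c : ℝ, 0 < c ∧ ∀ᶠ N : ℕ in atTop,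
        ∃ δ : ℝ≥0∞, 0 < δ ∧ ∀ Ψ : PeriodicTrialState N (sideLength ρ N),
          periodicEnergy v Ψ ≤ periodicGroundStateEnergy v N (sideLength ρ N) + δ →
            ENNReal.ofReal (c * N) ≤ condensateOccupation N (sideLength ρ N) Ψ.ψ) →
      ∃ ρ₁ : ℝ, 0 < ρ₁ ∧ ∀ ρ : ℝ, 0 < ρ → ρ < ρ₁ → ∃ c : ℝ, 0 < c ∧ ∀ᶠ n : ℕ in atTop,
        ∀ Φ : Config (n + 1) → ℝ, IsPeriodicGroundStateFK v (sideLength ρ (n + 1)) Φ → Continuous Φ →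
          ENNReal.ofReal (c * (n + 1)) ≤
            condensateOccupation (n + 1) (sideLength ρ (n + 1)) (fun X => (Φ X : ℂ)) :=
  Landed.stub_torusCondensateFloor

/-- **Stub 1b** (LANDED p111990, `Theorems/BECThomsonPrinciplePeriodicToDirichletOccupationSqLeSwapPurity.lean`):
`occupation(φ)² ≤ N² · swapPurity`. -/
theorem stub_occupationSqLeSwapPurity :
    ∀ (n : ℕ) (φ : Space → ℂ) (Ψ : Config (n + 1) → ℂ), Measurable φ → Measurable Ψ →
      (∫⁻ x, (‖φ x‖₊ : ℝ≥0∞) ^ 2) ≤ 1 → (∫⁻ X, (‖Ψ X‖₊ : ℝ≥0∞) ^ 2) ≠ ⊤ →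
        occupation (n + 1) φ Ψ ^ 2 ≤ ((n + 1 : ℕ) : ℝ≥0∞) ^ 2 * swapPurity n Ψ :=
  Landed.stub_occupationSqLeSwapPurity

/-- **Stub 2** (LANDED p111019, `Theorems/BECThomsonPrinciplePeriodicToDirichletSwapPurityDisintegration.lean`):
disintegration of the swap purity (unfolded `bathMeasure`, `condOverlap`). -/
theorem stub_swapPurityDisintegration :
    ∀ (n : ℕ) (Ψ : Config (n + 1) → ℂ), Measurable Ψ → (∫⁻ X, (‖Ψ X‖₊ : ℝ≥0∞) ^ 2) ≠ ⊤ →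
      swapPurity n Ψ =
        ∫⁻ Y, ∫⁻ Y',
          (‖∫ x, (starRingEnd ℂ) (Ψ (Matrix.vecCons x Y')) * Ψ (Matrix.vecCons x Y)‖₊ : ℝ≥0∞) ^ 2 /
            ((∫⁻ x, (‖Ψ (Matrix.vecCons x Y)‖₊ : ℝ≥0∞) ^ 2) *
              ∫⁻ x, (‖Ψ (Matrix.vecCons x Y')‖₊ : ℝ≥0∞) ^ 2)
          ∂(volume.withDensity fun Y => ∫⁻ x, (‖Ψ (Matrix.vecCons x Y)‖₊ : ℝ≥0∞) ^ 2)
          ∂(volume.withDensity fun Y => ∫⁻ x, (‖Ψ (Matrix.vecCons x Y)‖₊ : ℝ≥0∞) ^ 2) :=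
  Landed.stub_swapPurityDisintegration

/-- **Stub 3 = R1** (research): entropy budget of the wall, `m = 0`. -/
theorem stub_entropyBudget : EntropyBudget := by
  sorry

/-- **Stub 4 = R2** (research): torus overlap concentration at speed `N`. -/
theorem stub_torusOverlapConcentration : TorusOverlapConcentration := by
  sorry

/-- **Stub 5 = R3** (research): overlap stability under the wall's Doob factor. -/
theorem stub_overlapStability : OverlapStability := by
  sorry

/-- **Stub 7 = R2′** (research, design II): torus flatness concentration at speed `N`. -/
theorem stub_torusFlatnessConcentration : TorusFlatnessConcentration := by
  sorry

/-- **Stub 8 = R3″** (research, design II): slice alignment of Dirichlet near-minimisers with the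
torus ground state, bath by bath, in `L²` up to a phase. -/
theorem stub_sliceAlignment : SliceAlignment := by
  sorry

/-- **Stub 9** (LANDED p113719, `Theorems/BECThomsonPrinciplePeriodicToDirichletFlatnessTransfer.lean`,
design II): the flatness-transfer inequality (unfolded `condFlatness`, `mixedOverlap`). -/
theorem stub_flatnessTransfer :
    ∀ (n : ℕ) (L : ℝ) (G F : Config (n + 1) → ℂ) (Y : Config n), Measurable G → Measurable F →
      0 < L →
      (∫⁻ x, (‖G (Matrix.vecCons x Y)‖₊ : ℝ≥0∞) ^ 2) ≠ ⊤ →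
      (∫⁻ x, (‖F (Matrix.vecCons x Y)‖₊ : ℝ≥0∞) ^ 2) ≠ ⊤ →
      ∀ κ : ℝ, 0 ≤ κ → κ ≤ 1 →
        ENNReal.ofReal κ ≤
          (‖∫ x, (starRingEnd ℂ) (constantMode L x) * G (Matrix.vecCons x Y)‖₊ : ℝ≥0∞) ^ 2 /
            ∫⁻ x, (‖G (Matrix.vecCons x Y)‖₊ : ℝ≥0∞) ^ 2 →
        ENNReal.ofReal (1 - κ / 16) ≤
          (‖∫ x, (starRingEnd ℂ) (G (Matrix.vecCons x Y)) * F (Matrix.vecCons x Y)‖₊ : ℝ≥0∞) ^ 2 /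
            ((∫⁻ x, (‖G (Matrix.vecCons x Y)‖₊ : ℝ≥0∞) ^ 2) *
              ∫⁻ x, (‖F (Matrix.vecCons x Y)‖₊ : ℝ≥0∞) ^ 2) →
        ENNReal.ofReal (κ / 4) ≤
          (‖∫ x, (starRingEnd ℂ) (constantMode L x) * F (Matrix.vecCons x Y)‖₊ : ℝ≥0∞) ^ 2 /
            ∫⁻ x, (‖F (Matrix.vecCons x Y)‖₊ : ℝ≥0∞) ^ 2 :=
  Landed.stub_flatnessTransfer

/-- **Stub 6** (POOLED item stmt-AtomisticToContinuum-11786, verbatim the imported route decl): dilute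
BEC for the smooth class (finite, `C²`, finite range — hence bounded) implies the conjunct. -/
theorem stub_hardCoreExtension : BECConjugateDomination.HardCoreExtension := by
  sorry

/-- The unfolded stub signatures are definitionally the named statements. -/
example : TorusCondensateFloor := stub_torusCondensateFloor
example : OccupationSqLeSwapPurity := stub_occupationSqLeSwapPurity
example : SwapPurityDisintegration := stub_swapPurityDisintegration
example : FlatnessTransfer := stub_flatnessTransfer

/-! ### Glue: trivial potentials, and the smooth class is bounded -/

/-- A potential vanishing at every distance has the free interaction. -/
theorem interaction_eq_zero_of_forall {v : ℝ → ℝ≥0∞} (hv : ∀ x : Space, v ‖x‖ = 0) {N : ℕ}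
    (X : Config N) : interaction v X = interaction 0 X := by
  unfold interaction
  refine Finset.sum_congr rfl fun i _ => Finset.sum_congr rfl fun j _ => ?_
  rw [dist_eq_norm, hv, Pi.zero_apply]

/-- … hence the free energy, ground-state energy and condensate number. -/
theorem condensateNumber_eq_of_forall {v : ℝ → ℝ≥0∞} (hv : ∀ x : Space, v ‖x‖ = 0) (N : ℕ)
    (L : ℝ) : condensateNumber v N L = condensateNumber 0 N L := by
  have hE : ∀ Ψ : TrialState N L, energy v Ψ = energy 0 Ψ := fun Ψ => by
    unfold energy
    simp_rw [interaction_eq_zero_of_forall hv]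
  have hG : groundStateEnergy v N L = groundStateEnergy 0 N L := by
    unfold groundStateEnergy
    simp_rw [hE]
  unfold condensateNumber
  simp_rw [hE, hG]

/-- **Trivial potentials condense** (the free Dirichlet gas, tree `hasGroundStateBEC_zero`). -/
theorem hasGroundStateBEC_of_forall {v : ℝ → ℝ≥0∞} (hv : ∀ x : Space, v ‖x‖ = 0) {ρ : ℝ}
    (hρ : 0 < ρ) : HasGroundStateBEC v ρ := by
  obtain ⟨c, hc, h⟩ := hasGroundStateBEC_zero hρ
  refine ⟨c, hc, ?_⟩
  filter_upwards [h] with N hN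
  rwa [condensateNumber_eq_of_forall hv]

/-- **The smooth class reduces to the bounded dichotomy**: a finite-range `v`, finite everywhere, with
`x ↦ v(|x|)` of class `C²` on `ℝ³`, is bounded on `[0, ∞)`, and either vanishes at every distance or has
`∫ v(|x|) dx ≠ 0`. Hence `BoundedNontrivialBEC` gives the hypothesis of `HardCoreExtension`. -/
theorem smoothClassBEC_of_boundedNontrivialBEC (h : BoundedNontrivialBEC) :
    ∀ v : ℝ → ℝ≥0∞, IsRepulsiveFiniteRange v → (∀ r, v r ≠ ⊤) →
      ContDiff ℝ 2 (fun x : Space => (v ‖x‖).toReal) →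
      (∃ Cₑ : ℝ, ∀ x : Space, ‖iteratedFDeriv ℝ 2 (fun x : Space => (v ‖x‖).toReal) x‖ ≤
        Cₑ * Real.sqrt ((v ‖x‖).toReal)) →
      ∃ ρ₀ : ℝ, 0 < ρ₀ ∧ ∀ ρ : ℝ, 0 < ρ → ρ < ρ₀ → HasGroundStateBEC v ρ := by
  intro v hv hfin hC2 _hHess
  -- the continuous compactly supported profile `f(x) = v(|x|)`
  set f : Space → ℝ := fun x => (v ‖x‖).toReal with hf
  have hfc : Continuous f := hC2.continuous
  have hvf : ∀ x : Space, v ‖x‖ = ENNReal.ofReal (f x) := fun x => by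
    rw [hf, ENNReal.ofReal_toReal (hfin _)]
  obtain ⟨hmeas, R₀, hR₀⟩ := hv
  -- boundedness on `[0, ∞)`
  have hbdd : ∃ B : ℝ≥0, ∀ r, 0 ≤ r → v r ≤ B := by
    obtain ⟨M, hM⟩ := (isCompact_closedBall (0 : Space) (max R₀ 0)).exists_bound_of_continuousOn
      hfc.continuousOn
    refine ⟨Real.toNNReal (max M 0), fun r hr => ?_⟩
    rcases lt_or_ge R₀ r with hRr | hRr
    · rw [hR₀ r hRr]; exact bot_le
    · set e : Space := EuclideanSpace.single 0 r with he
      have hnorm : ‖e‖ = r := by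
        rw [he, PiLp.norm_single, Real.norm_eq_abs, abs_of_nonneg hr]
      have hmem : e ∈ Metric.closedBall (0 : Space) (max R₀ 0) := by
        rw [Metric.mem_closedBall, dist_zero_right, hnorm]
        exact hRr.trans (le_max_left _ _)
      have h1 : v r = ENNReal.ofReal (f e) := by rw [← hnorm]; exact hvf e
      rw [h1, ENNReal.ofReal, ENNReal.coe_le_coe]
      refine Real.toNNReal_le_toNNReal ((le_abs_self _).trans ((Real.norm_eq_abs _ ▸ hM e hmem).trans
        (le_max_left _ _)))
  by_cases htriv : ∀ x : Space, v ‖x‖ = 0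
  · exact ⟨1, one_pos, fun ρ hρ _ => hasGroundStateBEC_of_forall htriv hρ⟩
  · push Not at htriv
    obtain ⟨x₀, hx₀⟩ := htriv
    have hfx₀ : 0 < f x₀ := by
      have hne : f x₀ ≠ 0 := fun h0 => hx₀ (by rw [hvf, h0, ENNReal.ofReal_zero])
      exact lt_of_le_of_ne ENNReal.toReal_nonneg (Ne.symm hne)
    -- positivity of the integral from continuity at `x₀`
    have hint : (∫⁻ x : Space, v ‖x‖) ≠ 0 := by
      obtain ⟨δ, hδ, hball⟩ := Metric.continuous_iff.1 hfc x₀ (f x₀ / 2) (by positivity)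
      intro h0
      have hle : (∫⁻ x in Metric.ball x₀ δ, ENNReal.ofReal (f x₀ / 2)) ≤ ∫⁻ x : Space, v ‖x‖ := by
        calc (∫⁻ x in Metric.ball x₀ δ, ENNReal.ofReal (f x₀ / 2))
            ≤ ∫⁻ x in Metric.ball x₀ δ, v ‖x‖ := by
              refine setLIntegral_mono' measurableSet_ball fun x hx => ?_
              rw [hvf]
              refine ENNReal.ofReal_le_ofReal ?_
              have := hball x (Metric.mem_ball.1 hx)
              rw [Real.dist_eq, abs_lt] at this
              linarith [this.1]
          _ ≤ ∫⁻ x : Space, v ‖x‖ := setLIntegral_le_lintegral _ _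
      rw [h0, nonpos_iff_eq_zero, setLIntegral_const, mul_eq_zero] at hle
      rcases hle with h1 | h1
      · exact (ENNReal.ofReal_pos.2 (by positivity)).ne' h1
      · exact (Metric.measure_ball_pos volume x₀ hδ).ne' h1
    exact h v ⟨hmeas, R₀, hR₀⟩ hbdd hint

/-! ### Glue: Yau's entropy–event bound and the tensorisation of KL -/

/-- **Entropy–event bound** (Kipnis–Landim App. 1 Prop. 8.2) on a general measurable space:
`Q(A) · log(1 + 1/P(A)) ≤ log 2 + KL(Q‖P)`. [folklore] -/
theorem entropyEventBound {α : Type*} [MeasurableSpace α] (Q P : Measure α)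
    [IsProbabilityMeasure Q] [IsProbabilityMeasure P] {A : Set α} (hA : MeasurableSet A)
    (hPA : P A ≠ 0) (hfin : klDiv Q P ≠ ⊤) :
    (Q A).toReal * Real.log (1 + (P A).toReal⁻¹) ≤ Real.log 2 + (klDiv Q P).toReal := by
  set p : ℝ := (P A).toReal with hpdef
  have hp0 : 0 < p := ENNReal.toReal_pos hPA (measure_ne_top P A)
  have hp1 : 0 < 1 + p⁻¹ := by positivity
  set c : ℝ := Real.log (1 + p⁻¹) with hcdef
  have hc0 : 0 ≤ c := Real.log_nonneg (by linarith [inv_pos.2 hp0])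
  set ψ : α → ℝ := A.indicator (fun _ => c) with hψdef
  have hψm : Measurable ψ := measurable_const.indicator hA
  have hψb : ∀ x, |ψ x| ≤ c := by
    intro x
    by_cases hx : x ∈ A
    · simp only [hψdef, Set.indicator_of_mem hx, abs_of_nonneg hc0, le_refl]
    · simp only [hψdef, Set.indicator_of_notMem hx, abs_zero, hc0]
  have h := Literature.Probability.Divergences.integral_le_toReal_klDiv_add_log hfin hψm hψb
  have h1 : ∫ x, ψ x ∂Q = (Q A).toReal * c := by
    rw [hψdef, integral_indicator_const c hA, smul_eq_mul, measureReal_def]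
  have hexp : ∀ x, Real.exp (ψ x) = A.indicator (fun _ => p⁻¹) x + 1 := by
    intro x
    by_cases hx : x ∈ A
    · simp only [hψdef, Set.indicator_of_mem hx, hcdef, Real.exp_log hp1]
      ring
    · simp only [hψdef, Set.indicator_of_notMem hx, Real.exp_zero, zero_add]
  have h2 : ∫ x, Real.exp (ψ x) ∂P = 2 := by
    simp_rw [hexp]
    rw [integral_add ((integrable_const _).indicator hA) (integrable_const _),
      integral_indicator_const _ hA, integral_const, smul_eq_mul, smul_eq_mul, probReal_univ,
      measureReal_def, ← hpdef, mul_inv_cancel₀ hp0.ne']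
    norm_num
  rw [h1, h2] at h
  linarith

/-- **Yau's lever, usable form**: if `P(A) ≤ e^{-G}` (`G > 0`) and `KL(Q‖P) ≤ H`, then
`Q(A) ≤ (log 2 + H)/G` (if `P(A) = 0`, absolute continuity from `KL < ∞` gives `Q(A) = 0`).
[folklore] -/
theorem measureReal_le_of_klDiv_le {α : Type*} [MeasurableSpace α] (Q P : Measure α)
    [IsProbabilityMeasure Q] [IsProbabilityMeasure P] {A : Set α} (hA : MeasurableSet A)
    {G H : ℝ} (hG : 0 < G) (hH : 0 ≤ H) (hP : P A ≤ ENNReal.ofReal (Real.exp (-G)))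
    (hKL : klDiv Q P ≤ ENNReal.ofReal H) : (Q A).toReal ≤ (Real.log 2 + H) / G := by
  have hfin : klDiv Q P ≠ ⊤ := ne_top_of_le_ne_top ENNReal.ofReal_ne_top hKL
  have hRHS : 0 ≤ (Real.log 2 + H) / G := by positivity
  by_cases hPA : P A = 0
  · have hac : Q ≪ P := (klDiv_ne_top_iff.1 hfin).1
    rw [hac hPA, ENNReal.toReal_zero]
    exact hRHS
  · have h := entropyEventBound Q P hA hPA hfin
    have hp : (P A).toReal ≤ Real.exp (-G) :=
      ENNReal.toReal_le_of_le_ofReal (Real.exp_pos _).le hP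
    have hp0 : 0 < (P A).toReal := ENNReal.toReal_pos hPA (measure_ne_top P A)
    have hlog : G ≤ Real.log (1 + (P A).toReal⁻¹) := by
      have h1 : Real.exp G ≤ (P A).toReal⁻¹ := by
        rw [Real.exp_neg] at hp
        exact (le_inv_comm₀ hp0 (Real.exp_pos G)).1 hp
      calc G = Real.log (Real.exp G) := (Real.log_exp G).symm
        _ ≤ Real.log (1 + (P A).toReal⁻¹) :=
          Real.log_le_log (Real.exp_pos G) (h1.trans (by linarith))
    have hKL' : (klDiv Q P).toReal ≤ H := ENNReal.toReal_le_of_le_ofReal hH hKL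
    have hQ0 : 0 ≤ (Q A).toReal := ENNReal.toReal_nonneg
    rw [le_div_iff₀ hG]
    calc (Q A).toReal * G ≤ (Q A).toReal * Real.log (1 + (P A).toReal⁻¹) :=
          mul_le_mul_of_nonneg_left hlog hQ0
      _ ≤ Real.log 2 + (klDiv Q P).toReal := h
      _ ≤ Real.log 2 + H := by linarith

/-- KL divergence is invariant under a measurable embedding applied to both measures.
[folklore] -/
theorem klDiv_map_of_measurableEmbedding {α β : Type*} [MeasurableSpace α] [MeasurableSpace β]
    {f : α → β} (hf : MeasurableEmbedding f) (μ ν : Measure α) [IsFiniteMeasure μ]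
    [IsFiniteMeasure ν] : klDiv (μ.map f) (ν.map f) = klDiv μ ν := by
  by_cases hμν : μ ≪ ν
  · have h1 : μ.map f ≪ ν.map f := hμν.map hf.measurable
    rw [klDiv_eq_lintegral_klFun_of_ac h1, klDiv_eq_lintegral_klFun_of_ac hμν, hf.lintegral_map]
    refine lintegral_congr_ae ?_
    filter_upwards [hf.rnDeriv_map μ ν] with x hx
    rw [hx]
  · have h1 : ¬ μ.map f ≪ ν.map f := by
      intro h
      refine hμν (Measure.AbsolutelyContinuous.mk fun s _ hνs => ?_)
      have := h (s := f '' s) (by rw [hf.map_apply, hf.injective.preimage_image]; exact hνs)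
      rwa [hf.map_apply, hf.injective.preimage_image] at this
    rw [klDiv_of_not_ac hμν, klDiv_of_not_ac h1]

/-- **Tensorisation**: `KL(Q ⊗ Q ‖ P ⊗ P) = KL(Q‖P) + KL(Q‖P)` (chain rule twice, swapping the
factors by the measurable equivalence `Prod.swap`). [folklore] -/
theorem klDiv_prod_self {α : Type*} [MeasurableSpace α] (Q P : Measure α)
    [IsProbabilityMeasure Q] [IsProbabilityMeasure P] :
    klDiv (Q.prod Q) (P.prod P) = klDiv Q P + klDiv Q P := by
  have hsw : MeasurableEmbedding (Prod.swap : α × α → α × α) :=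
    (MeasurableEquiv.prodComm : α × α ≃ᵐ α × α).measurableEmbedding
  have h1 : klDiv (Q.prod Q) (P.prod P) =
      klDiv Q P + klDiv (Q ⊗ₘ Kernel.const α Q) (Q ⊗ₘ Kernel.const α P) := by
    rw [← Measure.compProd_const, ← Measure.compProd_const, klDiv_compProd_eq_add]
  have h2 : klDiv (Q ⊗ₘ Kernel.const α Q) (Q ⊗ₘ Kernel.const α P) = klDiv Q P := by
    rw [Measure.compProd_const, Measure.compProd_const]
    calc klDiv (Q.prod Q) (Q.prod P)
        = klDiv ((Q.prod Q).map Prod.swap) ((P.prod Q).map Prod.swap) := by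
          rw [Measure.prod_swap, Measure.prod_swap]
      _ = klDiv (Q.prod Q) (P.prod Q) := klDiv_map_of_measurableEmbedding hsw _ _
      _ = klDiv (Q ⊗ₘ Kernel.const α Q) (P ⊗ₘ Kernel.const α Q) := by
          rw [← Measure.compProd_const, ← Measure.compProd_const]
      _ = klDiv Q P := klDiv_compProd_left Q P _
  rw [h1, h2]

/-! ### Glue: the bath objects -/

section Bath

variable {n : ℕ}

/-- Total mass of the bath law is `‖Ψ‖₂²`. [folklore] -/
theorem bathMeasure_univ {Ψ : Config (n + 1) → ℂ} (hΨ : Measurable Ψ) :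
    bathMeasure n Ψ Set.univ = ∫⁻ X, (‖Ψ X‖₊ : ℝ≥0∞) ^ 2 := by
  rw [bathMeasure, withDensity_apply _ MeasurableSet.univ, Measure.restrict_univ,
    lintegral_lintegral_sq_nnnorm_vecCons hΨ]

/-- The bath law of a normalised wave function is a probability measure. [folklore] -/
theorem isProbabilityMeasure_bathMeasure {Ψ : Config (n + 1) → ℂ} (hΨ : Measurable Ψ)
    (h1 : ∫⁻ X, (‖Ψ X‖₊ : ℝ≥0∞) ^ 2 = 1) : IsProbabilityMeasure (bathMeasure n Ψ) :=
  ⟨by rw [bathMeasure_univ hΨ, h1]⟩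

/-- The conditional overlap is jointly measurable. [folklore] -/
theorem measurable_condOverlap {Ψ : Config (n + 1) → ℂ} (hΨ : Measurable Ψ) :
    Measurable fun p : Config n × Config n => condOverlap n Ψ p.1 p.2 := by
  have hK : Measurable fun p : Config n × Config n =>
      ∫ x, conj (Ψ (Matrix.vecCons x p.2)) * Ψ (Matrix.vecCons x p.1) := by
    have h := measurable_swapKernel hΨ
    have heq : (fun p : Config n × Config n =>
        ∫ x, conj (Ψ (Matrix.vecCons x p.2)) * Ψ (Matrix.vecCons x p.1)) =
        fun p => ∫ x, Ψ (Matrix.vecCons x p.1) * conj (Ψ (Matrix.vecCons x p.2)) := by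
      funext p
      exact integral_congr_ae (ae_of_all _ fun x => mul_comm _ _)
    rw [heq]
    exact h
  have hm := measurable_lintegral_sq_nnnorm_vecCons hΨ
  unfold condOverlap
  exact (hK.nnnorm.coe_nnreal_ennreal.pow_const 2).div
    ((hm.comp measurable_fst).mul (hm.comp measurable_snd))

/-- Product form of the disintegration: `∫∫ σ dQ dQ = ∫ σ d(Q ⊗ Q)` (Tonelli). [folklore] -/
theorem lintegral_prod_condOverlap {Ψ : Config (n + 1) → ℂ} (hΨ : Measurable Ψ)
    (μ : Measure (Config n)) [SFinite μ] :
    ∫⁻ p, condOverlap n Ψ p.1 p.2 ∂(μ.prod μ) = ∫⁻ Y, ∫⁻ Y', condOverlap n Ψ Y Y' ∂μ ∂μ :=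
  lintegral_prod _ (measurable_condOverlap hΨ).aemeasurable

/-- The cell state of a measurable real function is measurable. [folklore] -/
theorem measurable_cellState {L : ℝ} {Φ : Config (n + 1) → ℝ} (hΦ : Measurable Φ) :
    Measurable (cellState n L Φ) :=
  (Complex.measurable_ofReal.comp hΦ).indicator (measurableSet_cellN _ _)

/-- The cell state of a Feynman–Kac torus ground state is normalised on `(ℝ³)^N`. [folklore] -/
theorem lintegral_cellState_sq {v : ℝ → ℝ≥0∞} {L : ℝ} {Φ : Config (n + 1) → ℝ}
    (hΦ : IsPeriodicGroundStateFK v L Φ) :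
    ∫⁻ X, (‖cellState n L Φ X‖₊ : ℝ≥0∞) ^ 2 = 1 := by
  have hpt : ∀ X, (‖cellState n L Φ X‖₊ : ℝ≥0∞) ^ 2 =
      (cellN (n + 1) L).indicator (fun X => ENNReal.ofReal (Φ X) ^ 2) X := by
    intro X
    unfold cellState
    by_cases hX : X ∈ cellN (n + 1) L
    · rw [Set.indicator_of_mem hX, Set.indicator_of_mem hX, ennnorm_sq_ofReal_periodic,
        ENNReal.ofReal_pow (hΦ.nonneg X)]
    · simp [hX]
  simp_rw [hpt]
  rw [lintegral_indicator (measurableSet_cellN _ _), hΦ.norm_eq]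

/-- The constant-mode occupation of `Φ` read on the cell is the occupation of the constant mode in
the cell state (definitional). [folklore] -/
theorem condensateOccupation_eq_occupation_cellState (L : ℝ) (Φ : Config (n + 1) → ℝ) :
    condensateOccupation (n + 1) L (fun X => (Φ X : ℂ)) =
      occupation (n + 1) (constantMode L) (cellState n L Φ) := rfl

end Bath

/-! ### Glue: the Yau chain -/

/-- `L_N = (N/ρ)^{1/3} → ∞` along `N = n + 1`. [folklore] -/
theorem tendsto_sideLength_succ {ρ : ℝ} (hρ : 0 < ρ) :
    Tendsto (fun n : ℕ => sideLength ρ (n + 1)) atTop atTop := by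
  have h : Tendsto (fun N : ℕ => sideLength ρ N) atTop atTop := by
    unfold sideLength
    exact (tendsto_rpow_atTop (by norm_num : (0 : ℝ) < 1 / 3)).comp
      (tendsto_natCast_atTop_atTop.atTop_div_const hρ)
  exact h.comp (tendsto_add_atTop_nat 1)

/-- Real bookkeeping of the event bound: `(log 2 + 2(g/12)N)/(gN) ≤ 1/4` once `log 2 ≤ (g/12)N`.
[folklore] -/
theorem event_bookkeeping {g N : ℝ} (hg : 0 < g) (hN : 0 < N) (hlog : Real.log 2 ≤ g / 12 * N) :
    (Real.log 2 + 2 * (g / 12 * N)) / (g * N) ≤ 1 / 4 := by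
  rw [div_le_iff₀ (by positivity)]
  nlinarith

/-- **The Yau chain at fixed `N = n+1`** (all inputs instantiated): torus swap floor `c₁`,
`P⊗P`-rarity of `{σ_Φ < c₁/2}`, entropy budget `KL(Q‖P) ≤ (g/12)N` with `log 2 ≤ (g/12)N`,
overlap stability with `κ ≤ 1`, `ε₃ = κc₁/8 ≤ 1/8` ⇒ `swapPurity(Ψ) ≥ 15κc₁/64`. [folklore] -/
theorem swapPurity_ge_of_chain {n : ℕ} {Ψ Φc : Config (n + 1) → ℂ} (hΨ : Measurable Ψ)
    (hΦc : Measurable Φc) (hΨ1 : ∫⁻ X, (‖Ψ X‖₊ : ℝ≥0∞) ^ 2 = 1)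
    (hΦ1 : ∫⁻ X, (‖Φc X‖₊ : ℝ≥0∞) ^ 2 = 1)
    (hdis : SwapPurityDisintegration) {c₁ κ g : ℝ} (hc₁ : 0 < c₁) (hκ : 0 < κ) (hκ1 : κ ≤ 1)
    (hc₁1 : c₁ ≤ 1) (hg : 0 < g) (hlog : Real.log 2 ≤ g / 12 * (n + 1))
    (hfloor : ENNReal.ofReal c₁ ≤ swapPurity n Φc)
    (hrare : ((bathMeasure n Φc).prod (bathMeasure n Φc))
        {p | condOverlap n Φc p.1 p.2 < ENNReal.ofReal (1 / 2) *
          ∫⁻ q, condOverlap n Φc q.1 q.2 ∂((bathMeasure n Φc).prod (bathMeasure n Φc))} ≤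
        ENNReal.ofReal (Real.exp (-(g * (n + 1)))))
    (hKL : klDiv (bathMeasure n Ψ) (bathMeasure n Φc) ≤ ENNReal.ofReal (g / 12 * (n + 1)))
    (hstab : ((bathMeasure n Ψ).prod (bathMeasure n Ψ))
        {p | condOverlap n Ψ p.1 p.2 + ENNReal.ofReal (κ * c₁ / 8) <
          ENNReal.ofReal κ * condOverlap n Φc p.1 p.2} ≤ ENNReal.ofReal (κ * c₁ / 8)) :
    ENNReal.ofReal (15 * κ * c₁ / 64) ≤ swapPurity n Ψ := by
  -- the two probability spaces
  set P := bathMeasure n Φc with hPdef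
  set Q := bathMeasure n Ψ with hQdef
  haveI : IsProbabilityMeasure P := isProbabilityMeasure_bathMeasure hΦc hΦ1
  haveI : IsProbabilityMeasure Q := isProbabilityMeasure_bathMeasure hΨ hΨ1
  set σΦ : Config n × Config n → ℝ≥0∞ := fun p => condOverlap n Φc p.1 p.2 with hσΦ
  set σΨ : Config n × Config n → ℝ≥0∞ := fun p => condOverlap n Ψ p.1 p.2 with hσΨ
  have mσΦ : Measurable σΦ := measurable_condOverlap hΦc
  have mσΨ : Measurable σΨ := measurable_condOverlap hΨ
  have hN : (0 : ℝ) < n + 1 := by positivity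
  -- means
  have hmeanΦ : ∫⁻ p, σΦ p ∂(P.prod P) = swapPurity n Φc := by
    rw [hσΦ, lintegral_prod_condOverlap hΦc,
      ← hdis n Φc hΦc (by rw [hΦ1]; exact ENNReal.one_ne_top)]
  have hmeanΨ : ∫⁻ p, σΨ p ∂(Q.prod Q) = swapPurity n Ψ := by
    rw [hσΨ, lintegral_prod_condOverlap hΨ,
      ← hdis n Ψ hΨ (by rw [hΨ1]; exact ENNReal.one_ne_top)]
  -- the rare event `B = {σ_Φ < c₁/2}`
  set B : Set (Config n × Config n) := {p | σΦ p < ENNReal.ofReal (c₁ / 2)} with hBdef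
  have hBmeas : MeasurableSet B := measurableSet_lt mσΦ measurable_const
  have hPB : (P.prod P) B ≤ ENNReal.ofReal (Real.exp (-(g * (n + 1)))) := by
    refine le_trans (measure_mono fun p hp => ?_) hrare
    have h2 : ENNReal.ofReal (c₁ / 2) ≤ ENNReal.ofReal (1 / 2) * ∫⁻ q, σΦ q ∂(P.prod P) := by
      rw [hmeanΦ]
      calc ENNReal.ofReal (c₁ / 2) = ENNReal.ofReal (1 / 2) * ENNReal.ofReal c₁ := by
            rw [← ENNReal.ofReal_mul (by norm_num)]; ring_nf
        _ ≤ ENNReal.ofReal (1 / 2) * swapPurity n Φc := by gcongr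
    exact lt_of_lt_of_le hp h2
  -- entropy: `(Q⊗Q)(B) ≤ 1/4`
  have hKL2 : klDiv (Q.prod Q) (P.prod P) ≤ ENNReal.ofReal (2 * (g / 12 * (n + 1))) := by
    rw [klDiv_prod_self, two_mul, ENNReal.ofReal_add (by positivity) (by positivity)]
    exact add_le_add hKL hKL
  have hQB : (Q.prod Q) B ≤ ENNReal.ofReal (1 / 4) := by
    have h := measureReal_le_of_klDiv_le (Q.prod Q) (P.prod P) hBmeas (by positivity)
      (by positivity) hPB hKL2
    rw [ENNReal.le_ofReal_iff_toReal_le (measure_ne_top _ _) (by norm_num)]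
    exact h.trans (event_bookkeeping hg hN hlog)
  -- overlap stability: `(Q⊗Q)(C) ≤ κc₁/8 ≤ 1/8`
  set ε₃ : ℝ := κ * c₁ / 8 with hε₃
  have hε₃0 : 0 < ε₃ := by positivity
  have hε₃le : ε₃ ≤ 1 / 8 := by
    rw [hε₃]; nlinarith [mul_le_one₀ hκ1 hc₁.le hc₁1]
  set C : Set (Config n × Config n) :=
    {p | σΨ p + ENNReal.ofReal ε₃ < ENNReal.ofReal κ * σΦ p} with hCdef
  have hCmeas : MeasurableSet C :=
    measurableSet_lt (mσΨ.add measurable_const) (measurable_const.mul mσΦ)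
  have hQC : (Q.prod Q) C ≤ ENNReal.ofReal (1 / 8) :=
    hstab.trans (ENNReal.ofReal_le_ofReal hε₃le)
  -- on the good set `σ_Ψ ≥ κc₁/2 - ε₃ = 3κc₁/8`
  set a : ℝ := 3 * κ * c₁ / 8 with hadef
  have ha0 : 0 ≤ a := by positivity
  have hgood : (B ∪ C)ᶜ ⊆ {p | ENNReal.ofReal a ≤ σΨ p} := by
    intro p hp
    simp only [Set.mem_compl_iff, Set.mem_union, not_or, hBdef, hCdef, Set.mem_setOf_eq,
      not_lt] at hp
    obtain ⟨hpB, hpC⟩ := hp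
    have h1 : ENNReal.ofReal (κ * c₁ / 2) ≤ σΨ p + ENNReal.ofReal ε₃ :=
      calc ENNReal.ofReal (κ * c₁ / 2) = ENNReal.ofReal κ * ENNReal.ofReal (c₁ / 2) := by
            rw [← ENNReal.ofReal_mul hκ.le]; ring_nf
        _ ≤ ENNReal.ofReal κ * σΦ p := by gcongr
        _ ≤ σΨ p + ENNReal.ofReal ε₃ := hpC
    have h2 : ENNReal.ofReal a = ENNReal.ofReal (κ * c₁ / 2) - ENNReal.ofReal ε₃ := by
      rw [← ENNReal.ofReal_sub _ hε₃0.le, hadef, hε₃]; ring_nf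
    show ENNReal.ofReal a ≤ σΨ p
    rw [h2]
    exact tsub_le_iff_right.2 h1
  -- mass of the good set `≥ 5/8`
  have hmass : ENNReal.ofReal (5 / 8) ≤ (Q.prod Q) {p | ENNReal.ofReal a ≤ σΨ p} := by
    refine le_trans ?_ (measure_mono hgood)
    rw [prob_compl_eq_one_sub (hBmeas.union hCmeas)]
    have hU : (Q.prod Q) (B ∪ C) ≤ ENNReal.ofReal (3 / 8) :=
      calc (Q.prod Q) (B ∪ C) ≤ (Q.prod Q) B + (Q.prod Q) C := measure_union_le _ _
        _ ≤ ENNReal.ofReal (1 / 4) + ENNReal.ofReal (1 / 8) := add_le_add hQB hQC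
        _ = ENNReal.ofReal (3 / 8) := by rw [← ENNReal.ofReal_add (by norm_num) (by norm_num)]; norm_num
    calc ENNReal.ofReal (5 / 8) = 1 - ENNReal.ofReal (3 / 8) := by
          rw [← ENNReal.ofReal_one, ← ENNReal.ofReal_sub _ (by norm_num)]; norm_num
      _ ≤ 1 - (Q.prod Q) (B ∪ C) := tsub_le_tsub_left hU _
  -- Markov
  have hmarkov : ENNReal.ofReal a * (Q.prod Q) {p | ENNReal.ofReal a ≤ σΨ p} ≤
      ∫⁻ p, σΨ p ∂(Q.prod Q) := mul_meas_ge_le_lintegral mσΨ _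
  calc ENNReal.ofReal (15 * κ * c₁ / 64) = ENNReal.ofReal a * ENNReal.ofReal (5 / 8) := by
        rw [← ENNReal.ofReal_mul ha0, hadef]; ring_nf
    _ ≤ ENNReal.ofReal a * (Q.prod Q) {p | ENNReal.ofReal a ≤ σΨ p} := by gcongr
    _ ≤ ∫⁻ p, σΨ p ∂(Q.prod Q) := hmarkov
    _ = swapPurity n Ψ := hmeanΨ

/-- **The swap floor of the torus ground state** from the `n₀` floor (stubs 1a + 1b):
`n₀(Φ) ≥ c N`, `c ≤ 1` ⇒ `swapPurity(Φ_cell) ≥ c²`. [folklore] -/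
theorem swapPurity_cellState_ge {n : ℕ} {L : ℝ} (hL : 0 < L) {v : ℝ → ℝ≥0∞}
    {Φ : Config (n + 1) → ℝ} (hΦ : IsPeriodicGroundStateFK v L Φ)
    (hsq : OccupationSqLeSwapPurity) {c : ℝ} (hc : 0 ≤ c)
    (hfloor : ENNReal.ofReal (c * (n + 1)) ≤ condensateOccupation (n + 1) L (fun X => (Φ X : ℂ))) :
    ENNReal.ofReal (c ^ 2) ≤ swapPurity n (cellState n L Φ) := by
  have hm : Measurable (cellState n L Φ) := measurable_cellState hΦ.measurable
  have h1 : ∫⁻ X, (‖cellState n L Φ X‖₊ : ℝ≥0∞) ^ 2 = 1 := lintegral_cellState_sq hΦ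
  have hocc := hsq n (constantMode L) (cellState n L Φ) (measurable_constantMode L) hm
    (lintegral_constantMode_sq hL).le (by rw [h1]; exact ENNReal.one_ne_top)
  rw [← condensateOccupation_eq_occupation_cellState] at hocc
  set N : ℝ≥0∞ := ((n + 1 : ℕ) : ℝ≥0∞) with hNdef
  have hN0 : N ≠ 0 := by rw [hNdef]; exact_mod_cast Nat.succ_ne_zero n
  have hNtop : N ≠ ⊤ := by rw [hNdef]; exact ENNReal.natCast_ne_top _
  have hcN : ENNReal.ofReal (c * (n + 1)) = ENNReal.ofReal c * N := by
    rw [ENNReal.ofReal_mul hc, hNdef]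
    congr 1
    rw [← ENNReal.ofReal_natCast]
    push_cast
    rfl
  have key : (ENNReal.ofReal c * N) ^ 2 ≤ N ^ 2 * swapPurity n (cellState n L Φ) :=
    calc (ENNReal.ofReal c * N) ^ 2 = ENNReal.ofReal (c * (n + 1)) ^ 2 := by rw [hcN]
      _ ≤ condensateOccupation (n + 1) L (fun X => (Φ X : ℂ)) ^ 2 := by gcongr
      _ ≤ N ^ 2 * swapPurity n (cellState n L Φ) := hocc
  rw [mul_pow, mul_comm, ← ENNReal.ofReal_pow hc] at key
  exact (ENNReal.mul_le_mul_iff_right (pow_ne_zero 2 hN0) (ENNReal.pow_ne_top hNtop)).1 key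

/-- **The Yau chain** (glue): the six inputs and `A` give dilute BEC for bounded, non-trivial,
admissible potentials. [folklore] -/
theorem assembly : Assembly := by
  intro h1a h1b h2 hR1 hR2 hR3 hA v hv hbdd hnt
  obtain ⟨hvm, R₀, hR₀⟩ := hv
  obtain ⟨B, hB⟩ := hbdd
  obtain ⟨ρa, hρa, hFloor⟩ := h1a v ⟨hvm, R₀, hR₀⟩ ⟨B, hB⟩ (hA v ⟨hvm, R₀, hR₀⟩)
  obtain ⟨ρ1, hρ1, hR1v⟩ := hR1 v ⟨hvm, R₀, hR₀⟩ ⟨B, hB⟩ hnt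
  obtain ⟨ρ2, hρ2, hR2v⟩ := hR2 v ⟨hvm, R₀, hR₀⟩ ⟨B, hB⟩
  obtain ⟨ρ3, hρ3, hR3v⟩ := hR3 v ⟨hvm, R₀, hR₀⟩ ⟨B, hB⟩ hnt
  refine ⟨min (min ρa ρ1) (min ρ2 ρ3), lt_min (lt_min hρa hρ1) (lt_min hρ2 hρ3),
    fun ρ hρ hρlt => ?_⟩
  have hρa' : ρ < ρa := hρlt.trans_le ((min_le_left _ _).trans (min_le_left _ _))
  have hρ1' : ρ < ρ1 := hρlt.trans_le ((min_le_left _ _).trans (min_le_right _ _))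
  have hρ2' : ρ < ρ2 := hρlt.trans_le ((min_le_right _ _).trans (min_le_left _ _))
  have hρ3' : ρ < ρ3 := hρlt.trans_le ((min_le_right _ _).trans (min_le_right _ _))
  -- constants
  obtain ⟨c, hc, hFl⟩ := hFloor ρ hρ hρa'
  obtain ⟨g, hg, hR2e⟩ := hR2v ρ hρ hρ2' (1 / 2) (by norm_num) (by norm_num)
  obtain ⟨κ, hκ, hR3e⟩ := hR3v ρ hρ hρ3'
  set c' : ℝ := min c 1 with hc'def
  have hc'0 : 0 < c' := lt_min hc one_pos
  have hc'1 : c' ≤ 1 := min_le_right _ _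
  set κ' : ℝ := min κ 1 with hκ'def
  have hκ'0 : 0 < κ' := lt_min hκ one_pos
  have hκ'1 : κ' ≤ 1 := min_le_right _ _
  set c₁ : ℝ := c' ^ 2 with hc₁def
  have hc₁0 : 0 < c₁ := by positivity
  have hc₁1 : c₁ ≤ 1 := by rw [hc₁def]; nlinarith
  have hR1e := hR1v ρ hρ hρ1' (g / 12) (by positivity)
  have hR3e' := hR3e (κ' * c₁ / 8) (by positivity)
  -- eventualities in `n`
  have hℓ : ∀ᶠ n : ℕ in atTop, 2 * R₀ < sideLength ρ (n + 1) ∧ 0 < sideLength ρ (n + 1) :=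
    ((tendsto_sideLength_succ hρ).eventually_gt_atTop (2 * R₀)).and
      ((tendsto_sideLength_succ hρ).eventually_gt_atTop 0)
  have hlog : ∀ᶠ n : ℕ in atTop, Real.log 2 ≤ g / 12 * ((n : ℝ) + 1) := by
    have ht : Tendsto (fun n : ℕ => g / 12 * ((n : ℝ) + 1)) atTop atTop :=
      Tendsto.const_mul_atTop (by positivity)
        (tendsto_natCast_atTop_atTop.atTop_add tendsto_const_nhds)
    exact ht.eventually_ge_atTop _
  set c'' : ℝ := 15 * κ' * c₁ / 64 with hc''def
  have hc''0 : 0 < c'' := by positivity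
  -- the per-`n` statement
  have key : ∀ᶠ n : ℕ in atTop, ∃ δ : ℝ≥0∞, 0 < δ ∧
      ∀ Ψ : TrialState (n + 1) (sideLength ρ (n + 1)),
        energy v Ψ ≤ groundStateEnergy v (n + 1) (sideLength ρ (n + 1)) + δ →
          ENNReal.ofReal (c'' * ((n + 1 : ℕ) : ℝ)) ≤ maxOccupation (n + 1) Ψ.ψ := by
    filter_upwards [hFl, hR2e, hR1e, hR3e', hℓ, hlog] with n hFln hR2n hR1n hR3n hℓn hlogn
    obtain ⟨δ₁, hδ₁, hR1n⟩ := hR1n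
    obtain ⟨δ₃, hδ₃, hR3n⟩ := hR3n
    set ℓ : ℝ := sideLength ρ (n + 1) with hℓdef
    -- the torus Feynman–Kac ground state
    have hC : ∀ x, periodizedPotential v ℓ x ≤ (B : ℝ≥0∞) := fun x => by
      obtain ⟨n₀, hn₀⟩ := exists_periodizedPotential_eq_single hR₀ hℓn.1 hℓn.2 x
      rw [hn₀]
      exact hB _ (norm_nonneg _)
    obtain ⟨Φ, hΦ, hΦc, hΦpos⟩ := PeriodicGroundStateFeynmanKac_holds (n + 1) ℓ v
      (Nat.succ_le_succ (Nat.zero_le n)) hℓn.2 hvm ⟨B, hC⟩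
    refine ⟨min δ₁ δ₃, lt_min hδ₁ hδ₃, fun Ψ hΨ => ?_⟩
    have hΨ1 : energy v Ψ ≤ groundStateEnergy v (n + 1) ℓ + δ₁ :=
      hΨ.trans (add_le_add le_rfl (min_le_left _ _))
    have hΨ3 : energy v Ψ ≤ groundStateEnergy v (n + 1) ℓ + δ₃ :=
      hΨ.trans (add_le_add le_rfl (min_le_right _ _))
    have hΨm : Measurable Ψ.ψ := Ψ.contDiff.continuous.measurable
    -- floors on the torus side
    have hfl : ENNReal.ofReal (c' * (n + 1)) ≤ condensateOccupation (n + 1) ℓ (fun X => (Φ X : ℂ)) :=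
      le_trans (ENNReal.ofReal_le_ofReal (by nlinarith [min_le_left c 1])) (hFln Φ hΦ hΦc)
    have hswapΦ : ENNReal.ofReal c₁ ≤ swapPurity n (cellState n ℓ Φ) :=
      swapPurity_cellState_ge hℓn.2 hΦ h1b hc'0.le hfl
    -- overlap stability with `κ' ≤ κ`
    have hstab : ((bathMeasure n Ψ.ψ).prod (bathMeasure n Ψ.ψ))
        {p | condOverlap n Ψ.ψ p.1 p.2 + ENNReal.ofReal (κ' * c₁ / 8) <
          ENNReal.ofReal κ' * condOverlap n (cellState n ℓ Φ) p.1 p.2} ≤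
        ENNReal.ofReal (κ' * c₁ / 8) := by
      refine le_trans (measure_mono fun p hp => ?_) (hR3n Φ hΦ hΦc hΦpos Ψ hΨ3)
      exact lt_of_lt_of_le hp (mul_le_mul_left (ENNReal.ofReal_le_ofReal (min_le_left κ 1)) _)
    have hchain := swapPurity_ge_of_chain hΨm (measurable_cellState hΦ.measurable) Ψ.norm_eq
      (lintegral_cellState_sq hΦ) h2 hc₁0 hκ'0 hκ'1 hc₁1 hg hlogn hswapΦ
      (hR2n Φ hΦ hΦc hΦpos) (hR1n Φ hΦ hΦc hΦpos Ψ hΨ1) hstab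
    -- Penrose–Onsager
    calc ENNReal.ofReal (c'' * ((n + 1 : ℕ) : ℝ))
        = ((n + 1 : ℕ) : ℝ≥0∞) * ENNReal.ofReal c'' := by
          rw [mul_comm, ENNReal.ofReal_mul (by positivity), ENNReal.ofReal_natCast]
      _ ≤ ((n + 1 : ℕ) : ℝ≥0∞) * swapPurity n Ψ.ψ := by rw [hc''def]; gcongr
      _ ≤ maxOccupation (n + 1) Ψ.ψ := Ψ.succ_mul_swapPurity_le_maxOccupation
  -- conclusion: `HasGroundStateBEC v ρ`
  refine ⟨c'', hc''0, ?_⟩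
  rw [Filter.eventually_atTop] at key ⊢
  obtain ⟨n₀, hn₀⟩ := key
  refine ⟨n₀ + 1, fun N hN => ?_⟩
  obtain ⟨m, rfl⟩ := Nat.exists_eq_succ_of_ne_zero (by omega : N ≠ 0)
  obtain ⟨δ, hδ, hall⟩ := hn₀ m (by omega)
  exact le_condensateNumber v hδ hall

/-! ### Glue: design II (one bath, flatness) -/

section OneBath

variable {n : ℕ}

/-- The flat pairing of a zero slice vanishes. -/
theorem integral_conj_constantMode_mul_eq_zero {L : ℝ} {Ψ : Config (n + 1) → ℂ}
    (hΨ : Measurable Ψ) (Y : Config n) (h0 : ∫⁻ x, (‖Ψ (Matrix.vecCons x Y)‖₊ : ℝ≥0∞) ^ 2 = 0) :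
    ∫ x, conj (constantMode L x) * Ψ (Matrix.vecCons x Y) = 0 := by
  have hae : ∀ᵐ x : Space, Ψ (Matrix.vecCons x Y) = 0 := by
    have h := (lintegral_eq_zero_iff
      ((measurable_comp_vecCons_left hΨ Y).nnnorm.coe_nnreal_ennreal.pow_const 2)).1 h0
    filter_upwards [h] with x hx
    simpa using hx
  refine integral_eq_zero_of_ae ?_
  filter_upwards [hae] with x hx
  simp [hx]

/-- **One-bath disintegration**: `occupation N φ₀ Ψ = N ∫ κ_Ψ dQ` for `Ψ ∈ L²`. -/
theorem occupation_constantMode_eq_lintegral_condFlatness (L : ℝ) {Ψ : Config (n + 1) → ℂ}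
    (hΨ : Measurable Ψ) (hfin : (∫⁻ X, (‖Ψ X‖₊ : ℝ≥0∞) ^ 2) ≠ ⊤) :
    occupation (n + 1) (constantMode L) Ψ =
      ((n + 1 : ℕ) : ℝ≥0∞) * ∫⁻ Y, condFlatness n L Ψ Y ∂(bathMeasure n Ψ) := by
  have hmm : Measurable fun Y : Config n =>
      ∫⁻ x : Space, (‖Ψ (Matrix.vecCons x Y)‖₊ : ℝ≥0∞) ^ 2 :=
    measurable_lintegral_sq_nnnorm_vecCons hΨ
  have hae : ∀ᵐ Y : Config n, (∫⁻ x : Space, (‖Ψ (Matrix.vecCons x Y)‖₊ : ℝ≥0∞) ^ 2) < ⊤ :=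
    ae_lt_top hmm (by rwa [lintegral_lintegral_sq_nnnorm_vecCons hΨ])
  rw [bathMeasure, lintegral_withDensity_eq_lintegral_mul_non_measurable _ hmm hae]
  have hocc : occupation (n + 1) (constantMode L) Ψ = ((n + 1 : ℕ) : ℝ≥0∞) *
      ∫⁻ Y : Config n, (‖∫ x, conj (constantMode L x) * Ψ (Matrix.vecCons x Y)‖₊ : ℝ≥0∞) ^ 2 := by
    push_cast
    rfl
  rw [hocc]
  congr 1
  refine lintegral_congr_ae ?_
  filter_upwards [hae] with Y hY
  simp only [Pi.mul_apply, condFlatness]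
  refine (ENNReal.mul_div_cancel' (fun h0 => ?_) (fun htop => absurd htop hY.ne)).symm
  rw [integral_conj_constantMode_mul_eq_zero hΨ Y h0]
  simp


/-- Measurability of the flat pairing `Y ↦ ⟨φ₀, ψ_Y⟩`. -/
theorem measurable_flatPairing (L : ℝ) {Ψ : Config (n + 1) → ℂ} (hΨ : Measurable Ψ) :
    Measurable fun Y : Config n => ∫ x, conj (constantMode L x) * Ψ (Matrix.vecCons x Y) := by
  have hG : Measurable fun q : Config n × Space =>
      conj (constantMode L q.2) * Ψ (Matrix.vecCons q.2 q.1) :=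
    (Complex.continuous_conj.measurable.comp ((measurable_constantMode L).comp measurable_snd)).mul
      (hΨ.comp (measurable_vecCons.comp (measurable_snd.prodMk measurable_fst)))
  exact (hG.stronglyMeasurable.integral_prod_right' (ν := (volume : Measure Space))).measurable

/-- The conditional flatness is measurable. -/
theorem measurable_condFlatness (L : ℝ) {Ψ : Config (n + 1) → ℂ} (hΨ : Measurable Ψ) :
    Measurable (condFlatness n L Ψ) := by
  unfold condFlatness
  exact ((measurable_flatPairing L hΨ).nnnorm.coe_nnreal_ennreal.pow_const 2).div
    (measurable_lintegral_sq_nnnorm_vecCons hΨ)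

/-- Measurability of the mixed pairing `Y ↦ ⟨g_Y, f_Y⟩`. -/
theorem measurable_mixedPairing {G F : Config (n + 1) → ℂ} (hG : Measurable G)
    (hF : Measurable F) :
    Measurable fun Y : Config n =>
      ∫ x, conj (G (Matrix.vecCons x Y)) * F (Matrix.vecCons x Y) := by
  have hK : Measurable fun q : Config n × Space =>
      conj (G (Matrix.vecCons q.2 q.1)) * F (Matrix.vecCons q.2 q.1) :=
    (Complex.continuous_conj.measurable.comp
      (hG.comp (measurable_vecCons.comp (measurable_snd.prodMk measurable_fst)))).mul
      (hF.comp (measurable_vecCons.comp (measurable_snd.prodMk measurable_fst)))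
  exact (hK.stronglyMeasurable.integral_prod_right' (ν := (volume : Measure Space))).measurable

/-- The mixed overlap is measurable. -/
theorem measurable_mixedOverlap {G F : Config (n + 1) → ℂ} (hG : Measurable G)
    (hF : Measurable F) : Measurable (mixedOverlap n G F) := by
  unfold mixedOverlap
  exact ((measurable_mixedPairing hG hF).nnnorm.coe_nnreal_ennreal.pow_const 2).div
    ((measurable_lintegral_sq_nnnorm_vecCons hG).mul (measurable_lintegral_sq_nnnorm_vecCons hF))


/-- **Design II chain at fixed `N`**: flatness floor `E_P κ_Φ ≥ c'`, rarity of `{κ_Φ < c'/2}`,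
entropy budget, slice alignment at `η = c'/32`, flatness transfer ⇒ `E_Q κ_Ψ ≥ c'/16`. -/
theorem lintegral_condFlatness_ge_of_chainII {L : ℝ} (hL : 0 < L) {Ψ Φc : Config (n + 1) → ℂ}
    (hΨ : Measurable Ψ) (hΦc : Measurable Φc) (hΨ1 : ∫⁻ X, (‖Ψ X‖₊ : ℝ≥0∞) ^ 2 = 1)
    (hΦ1 : ∫⁻ X, (‖Φc X‖₊ : ℝ≥0∞) ^ 2 = 1) (hFT : FlatnessTransfer)
    {c g : ℝ} (hc : 0 < c) (hc1 : c ≤ 1) (hg : 0 < g) (hlog : Real.log 2 ≤ g / 12 * (n + 1))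
    (hfloor : ENNReal.ofReal c ≤ ∫⁻ Y, condFlatness n L Φc Y ∂(bathMeasure n Φc))
    (hrare : bathMeasure n Φc {Y | condFlatness n L Φc Y <
        ENNReal.ofReal (1 / 2) * ∫⁻ Y', condFlatness n L Φc Y' ∂(bathMeasure n Φc)} ≤
        ENNReal.ofReal (Real.exp (-(g * (n + 1)))))
    (hKL : klDiv (bathMeasure n Ψ) (bathMeasure n Φc) ≤ ENNReal.ofReal (g / 12 * (n + 1)))
    (halign : bathMeasure n Ψ {Y | mixedOverlap n Φc Ψ Y < ENNReal.ofReal (1 - c / 32)} ≤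
        ENNReal.ofReal (c / 32)) :
    ENNReal.ofReal (c / 16) ≤ ∫⁻ Y, condFlatness n L Ψ Y ∂(bathMeasure n Ψ) := by
  set P := bathMeasure n Φc with hPdef
  set Q := bathMeasure n Ψ with hQdef
  haveI : IsProbabilityMeasure P := isProbabilityMeasure_bathMeasure hΦc hΦ1
  haveI : IsProbabilityMeasure Q := isProbabilityMeasure_bathMeasure hΨ hΨ1
  have mκΦ : Measurable (condFlatness n L Φc) := measurable_condFlatness L hΦc
  have mκΨ : Measurable (condFlatness n L Ψ) := measurable_condFlatness L hΨ
  have mτ : Measurable (mixedOverlap n Φc Ψ) := measurable_mixedOverlap hΦc hΨ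
  have hN : (0 : ℝ) < n + 1 := by positivity
  -- slices are in L² (a.e. would do; we need it pointwise only on the good set, so go via ae)
  have hmΦ : Measurable fun Y : Config n =>
      ∫⁻ x : Space, (‖Φc (Matrix.vecCons x Y)‖₊ : ℝ≥0∞) ^ 2 :=
    measurable_lintegral_sq_nnnorm_vecCons hΦc
  have hmΨ : Measurable fun Y : Config n =>
      ∫⁻ x : Space, (‖Ψ (Matrix.vecCons x Y)‖₊ : ℝ≥0∞) ^ 2 :=
    measurable_lintegral_sq_nnnorm_vecCons hΨ
  -- the rare event
  set B : Set (Config n) := {Y | condFlatness n L Φc Y < ENNReal.ofReal (c / 2)} with hBdef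
  have hBmeas : MeasurableSet B := measurableSet_lt mκΦ measurable_const
  have hPB : P B ≤ ENNReal.ofReal (Real.exp (-(g * (n + 1)))) := by
    refine le_trans (measure_mono fun Y hY => ?_) hrare
    have h2 : ENNReal.ofReal (c / 2) ≤
        ENNReal.ofReal (1 / 2) * ∫⁻ Y', condFlatness n L Φc Y' ∂P :=
      calc ENNReal.ofReal (c / 2) = ENNReal.ofReal (1 / 2) * ENNReal.ofReal c := by
            rw [← ENNReal.ofReal_mul (by norm_num)]; ring_nf
        _ ≤ ENNReal.ofReal (1 / 2) * ∫⁻ Y', condFlatness n L Φc Y' ∂P := by gcongr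
    exact lt_of_lt_of_le hY h2
  have hQB : Q B ≤ ENNReal.ofReal (1 / 4) := by
    have h := measureReal_le_of_klDiv_le Q P hBmeas (by positivity) (by positivity) hPB hKL
    rw [ENNReal.le_ofReal_iff_toReal_le (measure_ne_top _ _) (by norm_num)]
    refine h.trans ?_
    rw [div_le_iff₀ (by positivity)]
    nlinarith
  -- the misaligned event
  set D : Set (Config n) := {Y | mixedOverlap n Φc Ψ Y < ENNReal.ofReal (1 - c / 32)} with hDdef
  have hDmeas : MeasurableSet D := measurableSet_lt mτ measurable_const
  have hQD : Q D ≤ ENNReal.ofReal (1 / 32) :=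
    halign.trans (ENNReal.ofReal_le_ofReal (by linarith))
  -- the null set of infinite slice norms (for Ψ; for Φc we use `Q ≪ P`-free pointwise finiteness?)
  -- We avoid `Q ≪ P`: both slice norms are finite `Q`-a.e. — for Ψ by Tonelli; for Φc we only need
  -- it where `condFlatness Φc Y ≥ c/2 > 0`, which forces the Φc-slice norm `≠ ⊤` (else `·/⊤ = 0`).
  have haeΨ : ∀ᵐ Y ∂Q, (∫⁻ x : Space, (‖Ψ (Matrix.vecCons x Y)‖₊ : ℝ≥0∞) ^ 2) < ⊤ := by
    have hvol : ∀ᵐ Y : Config n, (∫⁻ x : Space, (‖Ψ (Matrix.vecCons x Y)‖₊ : ℝ≥0∞) ^ 2) < ⊤ :=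
      ae_lt_top hmΨ (by rw [lintegral_lintegral_sq_nnnorm_vecCons hΨ, hΨ1]; exact ENNReal.one_ne_top)
    rw [hQdef, bathMeasure]
    exact (withDensity_absolutelyContinuous _ _).ae_le hvol
  -- good set
  set Gd : Set (Config n) := (B ∪ D)ᶜ ∩
    {Y | (∫⁻ x : Space, (‖Ψ (Matrix.vecCons x Y)‖₊ : ℝ≥0∞) ^ 2) < ⊤} with hGdef
  have hgood : Gd ⊆ {Y | ENNReal.ofReal (c / 8) ≤ condFlatness n L Ψ Y} := by
    intro Y hY
    simp only [hGdef, Set.mem_inter_iff, Set.mem_compl_iff, Set.mem_union, not_or, hBdef, hDdef,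
      Set.mem_setOf_eq, not_lt] at hY
    obtain ⟨⟨hYB, hYD⟩, hYfin⟩ := hY
    -- the Φc-slice norm is finite: otherwise `condFlatness Φc Y = 0 < c/2`
    have hΦfin : (∫⁻ x : Space, (‖Φc (Matrix.vecCons x Y)‖₊ : ℝ≥0∞) ^ 2) ≠ ⊤ := by
      intro htop
      have : condFlatness n L Φc Y = 0 := by
        unfold condFlatness; rw [htop, ENNReal.div_top]
      rw [this] at hYB
      exact absurd hYB (not_le.2 (ENNReal.ofReal_pos.2 (by positivity)))
    have key := hFT n L Φc Ψ Y hΦc hΨ hL hΦfin hYfin.ne (c / 2) (by positivity) (by linarith)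
      hYB (le_trans (le_of_eq (by ring_nf)) hYD)
    show ENNReal.ofReal (c / 8) ≤ condFlatness n L Ψ Y
    exact le_trans (le_of_eq (by ring_nf)) key
  have hmass : ENNReal.ofReal (1 / 2) ≤ Q {Y | ENNReal.ofReal (c / 8) ≤ condFlatness n L Ψ Y} := by
    refine le_trans ?_ (measure_mono hgood)
    have hnull : Q {Y | (∫⁻ x : Space, (‖Ψ (Matrix.vecCons x Y)‖₊ : ℝ≥0∞) ^ 2) < ⊤}ᶜ = 0 := by
      rw [Set.compl_setOf]
      exact ae_iff.1 haeΨ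
    have hGd : Q Gd = Q (B ∪ D)ᶜ := by
      rw [hGdef]
      exact measure_inter_conull hnull
    rw [hGd, prob_compl_eq_one_sub (hBmeas.union hDmeas)]
    have hU : Q (B ∪ D) ≤ ENNReal.ofReal (9 / 32) :=
      calc Q (B ∪ D) ≤ Q B + Q D := measure_union_le _ _
        _ ≤ ENNReal.ofReal (1 / 4) + ENNReal.ofReal (1 / 32) := add_le_add hQB hQD
        _ = ENNReal.ofReal (9 / 32) := by
            rw [← ENNReal.ofReal_add (by norm_num) (by norm_num)]; norm_num
    calc ENNReal.ofReal (1 / 2) ≤ ENNReal.ofReal (23 / 32) := ENNReal.ofReal_le_ofReal (by norm_num)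
      _ = 1 - ENNReal.ofReal (9 / 32) := by
          rw [← ENNReal.ofReal_one, ← ENNReal.ofReal_sub _ (by norm_num)]; norm_num
      _ ≤ 1 - Q (B ∪ D) := tsub_le_tsub_left hU _
  have hmarkov : ENNReal.ofReal (c / 8) * Q {Y | ENNReal.ofReal (c / 8) ≤ condFlatness n L Ψ Y} ≤
      ∫⁻ Y, condFlatness n L Ψ Y ∂Q := mul_meas_ge_le_lintegral mκΨ _
  calc ENNReal.ofReal (c / 16) = ENNReal.ofReal (c / 8) * ENNReal.ofReal (1 / 2) := by
        rw [← ENNReal.ofReal_mul (by positivity)]; ring_nf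
    _ ≤ ENNReal.ofReal (c / 8) * Q {Y | ENNReal.ofReal (c / 8) ≤ condFlatness n L Ψ Y} := by gcongr
    _ ≤ ∫⁻ Y, condFlatness n L Ψ Y ∂Q := hmarkov


/-- **Design II assembly**: `A` (through the landed torus floor), the flatness transfer, R1, R2′, R3″
give dilute BEC for bounded non-trivial `v`, via the FLAT-MODE occupation of all near-minimisers. -/
theorem boundedNontrivialBEC_of_oneBath (h1a : TorusCondensateFloor) (hFT : FlatnessTransfer)
    (hR1 : EntropyBudget) (hR2 : TorusFlatnessConcentration) (hR3 : SliceAlignment)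
    (hA : BECPeriodicReduction.PeriodicBEC) : BoundedNontrivialBEC := by
  intro v hv hbdd hnt
  obtain ⟨hvm, R₀, hR₀⟩ := hv
  obtain ⟨B, hB⟩ := hbdd
  obtain ⟨ρa, hρa, hFloor⟩ := h1a v ⟨hvm, R₀, hR₀⟩ ⟨B, hB⟩ (hA v ⟨hvm, R₀, hR₀⟩)
  obtain ⟨ρ1, hρ1, hR1v⟩ := hR1 v ⟨hvm, R₀, hR₀⟩ ⟨B, hB⟩ hnt
  obtain ⟨ρ2, hρ2, hR2v⟩ := hR2 v ⟨hvm, R₀, hR₀⟩ ⟨B, hB⟩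
  obtain ⟨ρ3, hρ3, hR3v⟩ := hR3 v ⟨hvm, R₀, hR₀⟩ ⟨B, hB⟩ hnt
  refine ⟨min (min ρa ρ1) (min ρ2 ρ3), lt_min (lt_min hρa hρ1) (lt_min hρ2 hρ3),
    fun ρ hρ hρlt => ?_⟩
  have hρa' : ρ < ρa := hρlt.trans_le ((min_le_left _ _).trans (min_le_left _ _))
  have hρ1' : ρ < ρ1 := hρlt.trans_le ((min_le_left _ _).trans (min_le_right _ _))
  have hρ2' : ρ < ρ2 := hρlt.trans_le ((min_le_right _ _).trans (min_le_left _ _))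
  have hρ3' : ρ < ρ3 := hρlt.trans_le ((min_le_right _ _).trans (min_le_right _ _))
  obtain ⟨c, hc, hFl⟩ := hFloor ρ hρ hρa'
  obtain ⟨g, hg, hR2e⟩ := hR2v ρ hρ hρ2' (1 / 2) (by norm_num) (by norm_num)
  set c' : ℝ := min c 1 with hc'def
  have hc'0 : 0 < c' := lt_min hc one_pos
  have hc'1 : c' ≤ 1 := min_le_right _ _
  have hR1e := hR1v ρ hρ hρ1' (g / 12) (by positivity)
  have hR3e := hR3v ρ hρ hρ3' (c' / 32) (by positivity)
  have hℓ : ∀ᶠ n : ℕ in atTop, 2 * R₀ < sideLength ρ (n + 1) ∧ 0 < sideLength ρ (n + 1) :=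
    ((tendsto_sideLength_succ hρ).eventually_gt_atTop (2 * R₀)).and
      ((tendsto_sideLength_succ hρ).eventually_gt_atTop 0)
  have hlog : ∀ᶠ n : ℕ in atTop, Real.log 2 ≤ g / 12 * ((n : ℝ) + 1) := by
    have ht : Tendsto (fun n : ℕ => g / 12 * ((n : ℝ) + 1)) atTop atTop :=
      Tendsto.const_mul_atTop (by positivity)
        (tendsto_natCast_atTop_atTop.atTop_add tendsto_const_nhds)
    exact ht.eventually_ge_atTop _
  set c'' : ℝ := c' / 16 with hc''def
  have hc''0 : 0 < c'' := by positivity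
  have key : ∀ᶠ n : ℕ in atTop, ∃ δ : ℝ≥0∞, 0 < δ ∧
      ∀ Ψ : TrialState (n + 1) (sideLength ρ (n + 1)),
        energy v Ψ ≤ groundStateEnergy v (n + 1) (sideLength ρ (n + 1)) + δ →
          ENNReal.ofReal (c'' * ((n + 1 : ℕ) : ℝ)) ≤ maxOccupation (n + 1) Ψ.ψ := by
    filter_upwards [hFl, hR2e, hR1e, hR3e, hℓ, hlog] with n hFln hR2n hR1n hR3n hℓn hlogn
    obtain ⟨δ₁, hδ₁, hR1n⟩ := hR1n
    obtain ⟨δ₃, hδ₃, hR3n⟩ := hR3n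
    set ℓ : ℝ := sideLength ρ (n + 1) with hℓdef
    have hC : ∀ x, periodizedPotential v ℓ x ≤ (B : ℝ≥0∞) := fun x => by
      obtain ⟨n₀, hn₀⟩ := exists_periodizedPotential_eq_single hR₀ hℓn.1 hℓn.2 x
      rw [hn₀]
      exact hB _ (norm_nonneg _)
    obtain ⟨Φ, hΦ, hΦc, hΦpos⟩ := PeriodicGroundStateFeynmanKac_holds (n + 1) ℓ v
      (Nat.succ_le_succ (Nat.zero_le n)) hℓn.2 hvm ⟨B, hC⟩
    refine ⟨min δ₁ δ₃, lt_min hδ₁ hδ₃, fun Ψ hΨ => ?_⟩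
    have hΨ1 : energy v Ψ ≤ groundStateEnergy v (n + 1) ℓ + δ₁ :=
      hΨ.trans (add_le_add le_rfl (min_le_left _ _))
    have hΨ3 : energy v Ψ ≤ groundStateEnergy v (n + 1) ℓ + δ₃ :=
      hΨ.trans (add_le_add le_rfl (min_le_right _ _))
    have hΨm : Measurable Ψ.ψ := Ψ.contDiff.continuous.measurable
    have hΦm : Measurable (cellState n ℓ Φ) := measurable_cellState hΦ.measurable
    have hΦ1 : ∫⁻ X, (‖cellState n ℓ Φ X‖₊ : ℝ≥0∞) ^ 2 = 1 := lintegral_cellState_sq hΦ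
    -- flatness floor of the torus ground state: `∫ κ_Φ dP ≥ c'`
    have hfl : ENNReal.ofReal (c' * (n + 1)) ≤ condensateOccupation (n + 1) ℓ (fun X => (Φ X : ℂ)) :=
      le_trans (ENNReal.ofReal_le_ofReal (by nlinarith [min_le_left c 1])) (hFln Φ hΦ hΦc)
    have hfloor : ENNReal.ofReal c' ≤
        ∫⁻ Y, condFlatness n ℓ (cellState n ℓ Φ) Y ∂(bathMeasure n (cellState n ℓ Φ)) := by
      rw [condensateOccupation_eq_occupation_cellState,
        occupation_constantMode_eq_lintegral_condFlatness ℓ hΦm (by rw [hΦ1]; exact ENNReal.one_ne_top)]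
        at hfl
      set N : ℝ≥0∞ := ((n + 1 : ℕ) : ℝ≥0∞) with hNdef
      have hN0 : N ≠ 0 := by rw [hNdef]; exact_mod_cast Nat.succ_ne_zero n
      have hNtop : N ≠ ⊤ := by rw [hNdef]; exact ENNReal.natCast_ne_top _
      have hcN : ENNReal.ofReal (c' * (n + 1)) = N * ENNReal.ofReal c' := by
        rw [mul_comm, ENNReal.ofReal_mul (by positivity), hNdef]
        congr 1
        rw [← ENNReal.ofReal_natCast]
        push_cast
        rfl
      rw [hcN] at hfl
      exact (ENNReal.mul_le_mul_iff_right hN0 hNtop).1 hfl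
    have hchain := lintegral_condFlatness_ge_of_chainII hℓn.2 hΨm hΦm Ψ.norm_eq hΦ1 hFT hc'0 hc'1
      hg hlogn hfloor (hR2n Φ hΦ hΦc hΦpos) (hR1n Φ hΦ hΦc hΦpos Ψ hΨ1) (hR3n Φ hΦ hΦc hΦpos Ψ hΨ3)
    -- flat-mode occupation ⇒ λ_max
    have hocc : ENNReal.ofReal (c'' * ((n + 1 : ℕ) : ℝ)) ≤ occupation (n + 1) (constantMode ℓ) Ψ.ψ := by
      rw [occupation_constantMode_eq_lintegral_condFlatness ℓ hΨm
        (by rw [Ψ.norm_eq]; exact ENNReal.one_ne_top)]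
      calc ENNReal.ofReal (c'' * ((n + 1 : ℕ) : ℝ))
          = ((n + 1 : ℕ) : ℝ≥0∞) * ENNReal.ofReal c'' := by
            rw [mul_comm, ENNReal.ofReal_mul (by positivity), ENNReal.ofReal_natCast]
        _ ≤ ((n + 1 : ℕ) : ℝ≥0∞) * ∫⁻ Y, condFlatness n ℓ Ψ.ψ Y ∂(bathMeasure n Ψ.ψ) := by
            rw [hc''def]; gcongr
    exact hocc.trans (occupation_le_maxOccupation Ψ.ψ (aestronglyMeasurable_constantMode ℓ)
      (lintegral_constantMode_sq hℓn.2))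
  refine ⟨c'', hc''0, ?_⟩
  rw [Filter.eventually_atTop] at key ⊢
  obtain ⟨n₀, hn₀⟩ := key
  refine ⟨n₀ + 1, fun N hN => ?_⟩
  obtain ⟨m, rfl⟩ := Nat.exists_eq_succ_of_ne_zero (by omega : N ≠ 0)
  obtain ⟨δ, hδ, hall⟩ := hn₀ m (by omega)
  exact le_condensateNumber v hδ hall


end OneBath

/-! ### Composition -/

/-- **The crux from the registered stubs (by name).** -/
theorem periodicToDirichlet_of_registered_stubs : BECThomsonPrinciple.PeriodicToDirichlet :=
  fun hA => stub_hardCoreExtension (smoothClassBEC_of_boundedNontrivialBEC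
    (assembly stub_torusCondensateFloor stub_occupationSqLeSwapPurity
      stub_swapPurityDisintegration stub_entropyBudget stub_torusOverlapConcentration
      stub_overlapStability hA))

/-- **The crux from the registered stubs, design II (by name).** -/
theorem periodicToDirichlet_of_registered_stubs_oneBath : BECThomsonPrinciple.PeriodicToDirichlet :=
  fun hA => stub_hardCoreExtension (smoothClassBEC_of_boundedNontrivialBEC
    (boundedNontrivialBEC_of_oneBath stub_torusCondensateFloor stub_flatnessTransfer
      stub_entropyBudget stub_torusFlatnessConcentration stub_sliceAlignment hA))

/-- Both designs inhabit their assembly statements. -/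
example : Assembly := assembly
example : AssemblyII := boundedNontrivialBEC_of_oneBath

/-- Sanity: the crux is literally `PeriodicBEC → conjunct`. -/
example : BECThomsonPrinciple.PeriodicToDirichlet =
    (BECPeriodicReduction.PeriodicBEC → _root_.BoseEinsteinCondensation) := rfl

end Summit.AtomisticToContinuum.BoseEinsteinCondensation.Cruxes.PeriodicToDirichlet.EntropySwap

end
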